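import Literature.Probability.LatticeModels.BesselIDebyeInterpolation
import Mathlib.Analysis.Complex.LocallyUniformLimit
import Mathlib.Analysis.Analytic.IsolatedZeros
import Mathlib.Analysis.Complex.Liouville
import Mathlib.Analysis.SpecialFunctions.Trigonometric.Series
import HarnessLib

/-!
# Fröhlich–Spencer's analytic interpolation of `n ↦ I_n(β)` on the strip: analyticity and
properties (c), (d) of FS81 Sect. 6

Third file of the formalisation of [FS81, Appendix B] (after `BesselIDebyeAsymptotics` = (B.12)
and `BesselIDebyeInterpolation` = (B.14) on the real line with (a), (b)). [FS81, Sect. 6, p. 576]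
requires a function `I_β(φ)`, complex analytic and non-zero in the strip `|Im φ| ≤ β/2`, with
(a) `I_β(n) = I_n(β)`; (b) even, positive, integrable on `ℝ`;
(c) `|I_β(φ+ia)/I_β(φ)| ≤ e^{g(a)/β}`, `0 ≤ g(a) ≤ const a²` (`|a| ≤ 1`), `≤ const e^{2π|a|}`
(`1 ≤ |a| ≤ β/2`); (d) `|∂_φ^m log(I_β(φ+ia)/I_β(φ))| ≤ Cβ⁻¹e^{2π|a|}`, `m = 1, 2`, `|a| ≤ β/2`,
uniformly in `φ ∈ ℝ` — "The proof of properties (a)–(d) follows easily from (B.12)–(B.14)"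
([FS81, p. 599]); [FS82, p. 433] invokes exactly this for the Wilson-action `U(1)` lattice gauge
theory (the tree's named fact
`Literature.MathematicalPhysics.QuantumFieldTheory.FrohlichSpencerU1PerimeterLawD4`). This file
supplies the complex-analytic half, with explicit constants, for `x = β ≥ 100`:

* `sincC` (`= dslope sin 0`, entire, `‖sinc z‖ ≤ e·e^{|Im z|}`), `sincSqKernelC` (entire continuation
  of the kernel `K`, `‖K(z)‖ ≤ e²e^{2π|Im z|}`, `≤ e^{2π|Im z|}/(π²‖z‖²)`), the uniform translate bound
  `∑_n ‖K(z - n)‖ ≤ (7e²/3) e^{2π|Im z|}`;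
* `debyeLogEC x z = ∑_n c_n K(z - n)` — the continuation of `log E_x`: ENTIRE
  (`differentiable_debyeLogEC`, locally uniform convergence), `= debyeLogE` on `ℝ`, and the
  **`e^{2π|a|}` bound** `‖log E_x(z)‖ ≤ (1800/x) e^{2π|Im z|}` (`norm_debyeLogEC_le`), whence by
  Cauchy's estimate `‖(log E_x)'(z)‖ ≤ (1800/x)e^{2π(|Im z|+1)}`, `‖(log E_x)''(z)‖ ≤ (1800/x)e^{2π(|Im z|+2)}`;
* the complex Debye exponent: `debyeR` (`√(1+w²)`), `debyeA` (`sinh⁻¹`), `debyeg`, analytic on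
  `|Im w| < 1` (where `Re(1+w²) > 0` and `Re(w + √(1+w²)) > 0`) with `R' = w/R`, `A' = 1/R`,
  `g' = -A`; `debyeG x` (`= log L_x` on `ℝ`, `debyeG_ofReal`) analytic on `|Im z| < x` with explicit
  `debyeG'`, `debyeG''` and `‖G_x''‖ ≤ 2/x` on `|Im z| ≤ 3x/4` (`norm_debyeG''_le`);
* vertical-segment calculus (`norm_sub_le_of_vertical`, `abs_re_sub_re_le_of_vertical`: the
  first-order term `ia f'(φ)` is imaginary when `f'(φ) ∈ ℝ`), giving **(B.13)**
  `|Re G_x(φ+ia) - G_x(φ)| ≤ a²/x` (`abs_re_debyeG_sub_le`, `|a| ≤ x/2`);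
* `besselIInterpC x z = exp(debyeLogI x z)`, `debyeLogI = debyeG + debyeLogEC` — FS81's `I_β(φ)`:
  zero-free, `DifferentiableOn` the strip `|Im z| < x` (twice FS's strip), `= besselIInterp` on `ℝ`
  (so (b) is `BesselIDebyeInterpolation`), **(a)** `besselIInterpC_intCast`;
  **(c)** `abs_re_debyeLogI_sub_le`: `|Re log I_x(φ+ia) - log I_x(φ)| ≤ (a² + 3600e^{2π|a|})/x`
  for `|a| ≤ x/2`, and `abs_re_debyeLogI_sub_le_sq`: `≤ (1 + 900e^{6π})a²/x` for `|a| ≤ 1`;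
  ratio form `norm_besselIInterpC_le`;
  **(d)** `hasDerivAt_debyeLogI_shift` / `hasDerivAt_debyeLogI'_shift` identify the `φ`-derivatives
  of `log I_x(φ+ia) - log I_x(φ)` with `F'(φ+ia) - F'(φ)`, `F''(φ+ia) - F''(φ)`, and
  `norm_debyeLogI'_sub_le` (`≤ (2|a| + 3600e^{2π}e^{2π|a|})/x`), `norm_debyeLogI''_sub_le`
  (`≤ (4 + 3600e^{4π}e^{2π|a|})/x`) for `|a| ≤ x/2`.

Constants are crude but explicit; FS81 only assert "const", "C". What is NOT here: the identity
`∑_n K(z - n) = 1`, sharper constants, and the use of (a)–(d) in [FS81, Sect. 6] / [FS82, §2].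

## References

* J. Fröhlich, T. Spencer, Comm. Math. Phys. 81 (1981) 527–602: Sect. 6, (a)–(d), p. 576;
  Appendix B, (B.12)–(B.14), p. 599. [FrohlichSpencerKT1981]
* J. Fröhlich, T. Spencer, Comm. Math. Phys. 83 (1982) 411–454, p. 433. [FrohlichSpencerCMP1982]
-/

noncomputable section

open MeasureTheory Set Filter Real Complex
open scoped Topology BigOperators

namespace Literature.Probability.LatticeModels

/-! ### The complex `sinc` -/

/-- The entire function `sinc z = sin z / z` (`sinc 0 = 1`), as the `dslope` of `Complex.sin` at `0`.
[folklore] -/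
def sincC (z : ℂ) : ℂ := dslope Complex.sin 0 z

/-- `sinc 0 = 1`. [folklore] -/
@[simp] theorem sincC_zero : sincC 0 = 1 := by
  rw [sincC, dslope_same, (Complex.hasDerivAt_sin 0).deriv, Complex.cos_zero]

/-- `sinc z = sin z / z` for `z ≠ 0`. [folklore] -/
theorem sincC_of_ne_zero {z : ℂ} (hz : z ≠ 0) : sincC z = Complex.sin z / z := by
  rw [sincC, dslope_of_ne _ hz, slope, Complex.sin_zero]
  simp [div_eq_inv_mul]

/-- `sinc` is entire. [folklore] -/
theorem differentiable_sincC : Differentiable ℂ sincC := by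
  intro z
  by_cases hz : z = 0
  · subst hz
    obtain ⟨p, hp⟩ := Complex.differentiable_sin.analyticAt (0 : ℂ)
    exact (hp.has_fpower_series_dslope_fslope.analyticAt).differentiableAt
  · exact (differentiableAt_dslope_of_ne hz).2 (Complex.differentiable_sin z)

/-- `sinc` is continuous. [folklore] -/
theorem continuous_sincC : Continuous sincC := differentiable_sincC.continuous

/-- On the real axis `sinc` is `Real.sinc`. [folklore] -/
theorem sincC_ofReal (u : ℝ) : sincC u = Real.sinc u := by
  by_cases hu : u = 0
  · subst hu; simp [Real.sinc_zero]
  · rw [sincC_of_ne_zero (by exact_mod_cast hu), Real.sinc_of_ne_zero hu]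
    push_cast
    rfl

/-- `‖sin z‖ ≤ e^{|Im z|}` (local copy of the same statement in
`Literature/NumberTheory/LFunctions/DeBruijnNewmanProofs.lean`, not imported here to keep this
special-functions file free of the L-function dependency). [folklore] -/
private theorem norm_sin_le_exp_abs_im (z : ℂ) : ‖Complex.sin z‖ ≤ Real.exp |z.im| := by
  have hz : Complex.sin z = (Real.sin z.re * Real.cosh z.im : ℝ) + (Real.cos z.re * Real.sinh z.im : ℝ) * I := by
    conv_lhs => rw [← Complex.re_add_im z]
    rw [Complex.sin_add, Complex.sin_mul_I, Complex.cos_mul_I]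
    push_cast
    ring
  rw [hz, Complex.norm_add_mul_I]
  have hcosh : Real.cosh z.im ≤ Real.exp |z.im| := by
    rw [Real.cosh_eq]
    have h1 : Real.exp z.im ≤ Real.exp |z.im| := Real.exp_le_exp.2 (le_abs_self _)
    have h2 : Real.exp (-z.im) ≤ Real.exp |z.im| := Real.exp_le_exp.2 (neg_le_abs _)
    linarith
  calc √((Real.sin z.re * Real.cosh z.im) ^ 2 + (Real.cos z.re * Real.sinh z.im) ^ 2)
      ≤ √(Real.cosh z.im ^ 2) := by
        apply Real.sqrt_le_sqrt
        have h1 := Real.sin_sq_add_cos_sq z.re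
        have h2 := Real.cosh_sq z.im
        nlinarith [sq_nonneg (Real.cos z.re), sq_nonneg (Real.sinh z.im)]
    _ = Real.cosh z.im := Real.sqrt_sq (Real.cosh_pos _).le
    _ ≤ Real.exp |z.im| := hcosh

/-- `‖sin z‖ ≤ e ‖z‖` for `‖z‖ ≤ 1` (from the power series). [folklore] -/
theorem norm_sin_le_exp_one_mul_norm {z : ℂ} (hz : ‖z‖ ≤ 1) : ‖Complex.sin z‖ ≤ Real.exp 1 * ‖z‖ := by
  have hs := Complex.hasSum_sin z
  have hexp : HasSum (fun n : ℕ => (1 : ℝ) ^ n / n.factorial) (Real.exp 1) := by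
    rw [Real.exp_eq_exp_ℝ]
    exact NormedSpace.expSeries_div_hasSum_exp 1
  simp only [one_pow] at hexp
  have hbound : ∀ n : ℕ, ‖(-1) ^ n * z ^ (2 * n + 1) / ((2 * n + 1).factorial : ℂ)‖ ≤
      ‖z‖ * (1 / n.factorial) := by
    intro n
    rw [norm_div, norm_mul, norm_pow, norm_neg, norm_one, one_pow, one_mul, norm_pow,
      Complex.norm_natCast]
    have hf : ((n.factorial : ℕ) : ℝ) ≤ ((2 * n + 1).factorial : ℕ) :=
      by exact_mod_cast Nat.factorial_le (by omega)
    have hfpos : (0 : ℝ) < n.factorial := by exact_mod_cast Nat.factorial_pos n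
    have hzn : ‖z‖ ^ (2 * n + 1) ≤ ‖z‖ := by
      rw [pow_succ]
      calc ‖z‖ ^ (2 * n) * ‖z‖ ≤ 1 * ‖z‖ := by
            gcongr; exact pow_le_one₀ (norm_nonneg _) hz
        _ = ‖z‖ := one_mul _
    rw [div_le_iff₀ (by positivity)]
    calc ‖z‖ ^ (2 * n + 1) ≤ ‖z‖ := hzn
      _ = ‖z‖ * (1 / n.factorial) * n.factorial := by field_simp
      _ ≤ ‖z‖ * (1 / n.factorial) * ((2 * n + 1).factorial : ℕ) := by gcongr
  have hsum : Summable fun n : ℕ => ‖z‖ * (1 / (n.factorial : ℝ)) := hexp.summable.mul_left _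
  calc ‖Complex.sin z‖ = ‖∑' n : ℕ, (-1) ^ n * z ^ (2 * n + 1) / ((2 * n + 1).factorial : ℂ)‖ := by
        rw [hs.tsum_eq]
    _ ≤ ∑' n : ℕ, ‖(-1) ^ n * z ^ (2 * n + 1) / ((2 * n + 1).factorial : ℂ)‖ :=
        norm_tsum_le_tsum_norm (Summable.of_nonneg_of_le (fun n => norm_nonneg _) hbound hsum)
    _ ≤ ∑' n : ℕ, ‖z‖ * (1 / (n.factorial : ℝ)) :=
        Summable.tsum_le_tsum hbound (Summable.of_nonneg_of_le (fun n => norm_nonneg _) hbound hsum) hsum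
    _ = ‖z‖ * Real.exp 1 := by rw [tsum_mul_left, hexp.tsum_eq]
    _ = Real.exp 1 * ‖z‖ := mul_comm _ _

/-- **Uniform exponential bound for the complex `sinc`**: `‖sinc z‖ ≤ e · e^{|Im z|}` for all `z`.
[folklore] -/
theorem norm_sincC_le (z : ℂ) : ‖sincC z‖ ≤ Real.exp 1 * Real.exp |z.im| := by
  have he : 1 ≤ Real.exp 1 := Real.one_le_exp zero_le_one
  have hi : 1 ≤ Real.exp |z.im| := Real.one_le_exp (abs_nonneg _)
  by_cases hz : z = 0
  · subst hz; rw [sincC_zero, norm_one]; nlinarith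
  have hzpos : 0 < ‖z‖ := norm_pos_iff.2 hz
  rw [sincC_of_ne_zero hz, norm_div]
  rcases le_or_gt ‖z‖ 1 with h1 | h1
  · rw [div_le_iff₀ hzpos]
    calc ‖Complex.sin z‖ ≤ Real.exp 1 * ‖z‖ := norm_sin_le_exp_one_mul_norm h1
      _ ≤ Real.exp 1 * Real.exp |z.im| * ‖z‖ := by
          rw [mul_assoc]; gcongr; nlinarith
  · rw [div_le_iff₀ hzpos]
    have h2 : 1 ≤ Real.exp 1 * ‖z‖ := by nlinarith
    calc ‖Complex.sin z‖ ≤ Real.exp |z.im| := norm_sin_le_exp_abs_im z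
      _ = Real.exp |z.im| * 1 := (mul_one _).symm
      _ ≤ Real.exp |z.im| * (Real.exp 1 * ‖z‖) := by gcongr
      _ = Real.exp 1 * Real.exp |z.im| * ‖z‖ := by ring

/-- `‖sinc z‖ ≤ e^{|Im z|}/‖z‖` for `z ≠ 0`. [folklore] -/
theorem norm_sincC_le_div {z : ℂ} (hz : z ≠ 0) : ‖sincC z‖ ≤ Real.exp |z.im| / ‖z‖ := by
  rw [sincC_of_ne_zero hz, norm_div]
  gcongr
  exact norm_sin_le_exp_abs_im z

/-! ### The complex `sinc²` kernel `K(z) = sinc(πz)²` -/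

/-- The kernel `K(z) = sin²(πz)/(π²z²)` of [FS81, (B.14)] as an entire function.
[cite: FrohlichSpencerKT1981, Appendix B, (B.14), p. 599] -/
def sincSqKernelC (z : ℂ) : ℂ := sincC (π * z) ^ 2

/-- `K` is entire. [folklore] -/
theorem differentiable_sincSqKernelC : Differentiable ℂ sincSqKernelC :=
  (differentiable_sincC.comp ((differentiable_const _).mul differentiable_id)).pow 2

/-- On the real axis `K` is `sincSqKernel`. [folklore] -/
theorem sincSqKernelC_ofReal (u : ℝ) : sincSqKernelC u = sincSqKernel u := by
  unfold sincSqKernelC sincSqKernel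
  rw [show (π : ℂ) * u = ((π * u : ℝ) : ℂ) by push_cast; ring, sincC_ofReal]
  push_cast
  ring

/-- `‖K(z)‖ ≤ e² e^{2π|Im z|}` for all `z`. [folklore] -/
theorem norm_sincSqKernelC_le (z : ℂ) : ‖sincSqKernelC z‖ ≤ Real.exp 2 * Real.exp (2 * π * |z.im|) := by
  unfold sincSqKernelC
  rw [norm_pow]
  have h := norm_sincC_le (π * z)
  have him : |(π * z : ℂ).im| = π * |z.im| := by
    rw [Complex.mul_im, Complex.ofReal_re, Complex.ofReal_im, zero_mul, add_zero, abs_mul,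
      abs_of_pos Real.pi_pos]
  rw [him] at h
  calc ‖sincC (π * z)‖ ^ 2 ≤ (Real.exp 1 * Real.exp (π * |z.im|)) ^ 2 := by
        gcongr
    _ = Real.exp 2 * Real.exp (2 * π * |z.im|) := by
        rw [mul_pow, ← Real.exp_nat_mul, ← Real.exp_nat_mul]; push_cast; ring_nf

/-- `‖K(z)‖ ≤ e^{2π|Im z|}/(π²‖z‖²)` for `z ≠ 0`. [folklore] -/
theorem norm_sincSqKernelC_le_div {z : ℂ} (hz : z ≠ 0) :
    ‖sincSqKernelC z‖ ≤ Real.exp (2 * π * |z.im|) / (π ^ 2 * ‖z‖ ^ 2) := by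
  unfold sincSqKernelC
  rw [norm_pow]
  have hπz : (π : ℂ) * z ≠ 0 := mul_ne_zero (by exact_mod_cast Real.pi_ne_zero) hz
  have h := norm_sincC_le_div hπz
  have him : |(π * z : ℂ).im| = π * |z.im| := by
    rw [Complex.mul_im, Complex.ofReal_re, Complex.ofReal_im, zero_mul, add_zero, abs_mul,
      abs_of_pos Real.pi_pos]
  have hnorm : ‖(π : ℂ) * z‖ = π * ‖z‖ := by
    rw [norm_mul, Complex.norm_real, Real.norm_eq_abs, abs_of_pos Real.pi_pos]
  rw [him, hnorm] at h
  calc ‖sincC (π * z)‖ ^ 2 ≤ (Real.exp (π * |z.im|) / (π * ‖z‖)) ^ 2 := by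
        gcongr
    _ = Real.exp (2 * π * |z.im|) / (π ^ 2 * ‖z‖ ^ 2) := by
        rw [div_pow, mul_pow, ← Real.exp_nat_mul]; push_cast; ring_nf

/-- `‖K(z)‖ ≤ e^{2π|Im z|}/(π² (Re z)²)` for `Re z ≠ 0` (since `‖z‖ ≥ |Re z|`). [folklore] -/
theorem norm_sincSqKernelC_le_div_re {z : ℂ} (hz : z.re ≠ 0) :
    ‖sincSqKernelC z‖ ≤ Real.exp (2 * π * |z.im|) / (π ^ 2 * z.re ^ 2) := by
  have hz0 : z ≠ 0 := fun h => hz (by rw [h]; simp)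
  have hre : z.re ^ 2 ≤ ‖z‖ ^ 2 := by
    rw [← sq_abs z.re]
    exact pow_le_pow_left₀ (abs_nonneg _) (Complex.abs_re_le_norm z) 2
  have hre0 : 0 < z.re ^ 2 := by positivity
  calc ‖sincSqKernelC z‖ ≤ Real.exp (2 * π * |z.im|) / (π ^ 2 * ‖z‖ ^ 2) := norm_sincSqKernelC_le_div hz0
    _ ≤ Real.exp (2 * π * |z.im|) / (π ^ 2 * z.re ^ 2) := by
        apply div_le_div_of_nonneg_left (Real.exp_pos _).le (by positivity)
        exact mul_le_mul_of_nonneg_left hre (by positivity)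

/-! ### The translates of the complex kernel are uniformly summable -/

/-- Termwise bound after centring at `m = ⌊Re z⌋`: with `δ = Re z - m ∈ [0,1)`,
`‖K(z - (m + j))‖ ≤ e² e^{2π|Im z|} b(j)`. [folklore] -/
theorem norm_sincSqKernelC_sub_le_sincSqBound (z : ℂ) (j : ℤ) :
    ‖sincSqKernelC (z - ((⌊z.re⌋ + j : ℤ) : ℂ))‖ ≤
      Real.exp 2 * Real.exp (2 * π * |z.im|) * sincSqBound j := by
  set m := ⌊z.re⌋ with hm
  have hδ0 : 0 ≤ z.re - m := by rw [hm]; linarith [Int.floor_le z.re]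
  have hδ1 : z.re - m < 1 := by rw [hm]; linarith [Int.lt_floor_add_one z.re]
  have hre : (z - ((m + j : ℤ) : ℂ)).re = (z.re - m) - j := by
    push_cast
    simp only [Complex.sub_re, Complex.add_re, Complex.intCast_re]
    ring
  have him : (z - ((m + j : ℤ) : ℂ)).im = z.im := by
    simp only [Complex.sub_im, Complex.intCast_im, sub_zero]
  have he2 : 1 ≤ Real.exp 2 := Real.one_le_exp (by norm_num)
  by_cases h : j ≤ -1 ∨ ¬ j ≤ 1
  · obtain ⟨hne, hle⟩ := inv_sq_le_sincSqBound hδ0 hδ1 h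
    have hne' : (z - ((m + j : ℤ) : ℂ)).re ≠ 0 := by rwa [hre]
    calc ‖sincSqKernelC (z - ((m + j : ℤ) : ℂ))‖
        ≤ Real.exp (2 * π * |(z - ((m + j : ℤ) : ℂ)).im|) / (π ^ 2 * (z - ((m + j : ℤ) : ℂ)).re ^ 2) :=
          norm_sincSqKernelC_le_div_re hne'
      _ = Real.exp (2 * π * |z.im|) * (1 / (π ^ 2 * ((z.re - m) - j) ^ 2)) := by
          rw [him, hre]; ring
      _ ≤ Real.exp (2 * π * |z.im|) * sincSqBound j := by gcongr
      _ ≤ Real.exp 2 * Real.exp (2 * π * |z.im|) * sincSqBound j := by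
          have h0 : 0 ≤ Real.exp (2 * π * |z.im|) * sincSqBound j :=
            mul_nonneg (Real.exp_pos _).le (sincSqBound_nonneg j)
          nlinarith
  · rw [not_or, not_not] at h
    rw [sincSqBound_of_mem h.1 h.2, mul_one]
    calc ‖sincSqKernelC (z - ((m + j : ℤ) : ℂ))‖
        ≤ Real.exp 2 * Real.exp (2 * π * |(z - ((m + j : ℤ) : ℂ)).im|) := norm_sincSqKernelC_le _
      _ = Real.exp 2 * Real.exp (2 * π * |z.im|) := by rw [him]

/-- `∑_{n ∈ ℤ} ‖K(z - n)‖` converges for every complex `z`. [folklore] -/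
theorem summable_norm_sincSqKernelC_sub (z : ℂ) : Summable fun n : ℤ => ‖sincSqKernelC (z - n)‖ := by
  set m := ⌊z.re⌋ with hm
  have hs : Summable fun j : ℤ => ‖sincSqKernelC (z - ((m + j : ℤ) : ℂ))‖ :=
    Summable.of_nonneg_of_le (fun j => norm_nonneg _) (norm_sincSqKernelC_sub_le_sincSqBound z)
      (hasSum_sincSqBound.summable.mul_left _)
  exact (Equiv.summable_iff (Equiv.addLeft m) (f := fun n : ℤ => ‖sincSqKernelC (z - n)‖)).1 hs

/-- The uniform bound `∑_{n ∈ ℤ} ‖K(z - n)‖ ≤ (7e²/3) e^{2π|Im z|}`. [folklore] -/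
theorem tsum_norm_sincSqKernelC_sub_le (z : ℂ) :
    ∑' n : ℤ, ‖sincSqKernelC (z - n)‖ ≤ Real.exp 2 * Real.exp (2 * π * |z.im|) * (7 / 3) := by
  set m := ⌊z.re⌋ with hm
  have hle := norm_sincSqKernelC_sub_le_sincSqBound z
  have hs : Summable fun j : ℤ => ‖sincSqKernelC (z - ((m + j : ℤ) : ℂ))‖ :=
    Summable.of_nonneg_of_le (fun j => norm_nonneg _) hle (hasSum_sincSqBound.summable.mul_left _)
  rw [← Equiv.tsum_eq (Equiv.addLeft m)]
  simp only [Equiv.coe_addLeft]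
  calc ∑' j : ℤ, ‖sincSqKernelC (z - ((m + j : ℤ) : ℂ))‖
      ≤ ∑' j : ℤ, Real.exp 2 * Real.exp (2 * π * |z.im|) * sincSqBound j :=
        Summable.tsum_le_tsum hle hs (hasSum_sincSqBound.summable.mul_left _)
    _ = Real.exp 2 * Real.exp (2 * π * |z.im|) * (7 / 3) := by
        rw [tsum_mul_left, hasSum_sincSqBound.tsum_eq]

/-! ### The correction factor `E_x` on `ℂ` -/

/-- `log E_x(z) = ∑_{n ∈ ℤ} c_n(x) K(z - n)` for complex `z` ([FS81, (B.14)]).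
[cite: FrohlichSpencerKT1981, Appendix B, (B.14), p. 599] -/
def debyeLogEC (x : ℝ) (z : ℂ) : ℂ := ∑' n : ℤ, (debyeCorr x n : ℂ) * sincSqKernelC (z - n)

/-- The series converges absolutely (`x > 0`). [folklore] -/
theorem summable_norm_debyeLogEC_term {x : ℝ} (hx : 0 < x) (z : ℂ) :
    Summable fun n : ℤ => ‖(debyeCorr x n : ℂ) * sincSqKernelC (z - n)‖ := by
  obtain ⟨M, hM⟩ := exists_forall_abs_debyeCorr_le hx
  refine Summable.of_nonneg_of_le (fun n => norm_nonneg _) (fun n => ?_)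
    ((summable_norm_sincSqKernelC_sub z).mul_left M)
  rw [norm_mul, Complex.norm_real, Real.norm_eq_abs]
  exact mul_le_mul_of_nonneg_right (hM n) (norm_nonneg _)

/-- On the real axis `log E_x` is the real series `debyeLogE`. [folklore] -/
theorem debyeLogEC_ofReal (x : ℝ) (φ : ℝ) : debyeLogEC x φ = debyeLogE x φ := by
  unfold debyeLogEC debyeLogE
  rw [Complex.ofReal_tsum]
  refine tsum_congr fun n => ?_
  rw [show (φ : ℂ) - (n : ℂ) = ((φ - n : ℝ) : ℂ) by push_cast; ring, sincSqKernelC_ofReal]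
  push_cast
  ring

/-- **The `e^{2π|Im z|}` bound** ([FS81, source of the factor `e^{2π|a|}` in (c), (d) p. 576]):
for `x ≥ 100`, `‖log E_x(z)‖ ≤ (1800/x) e^{2π|Im z|}`. [cite: FrohlichSpencerKT1981, Appendix B, (B.14), p. 599] -/
theorem norm_debyeLogEC_le {x : ℝ} (hx : 100 ≤ x) (z : ℂ) :
    ‖debyeLogEC x z‖ ≤ 1800 / x * Real.exp (2 * π * |z.im|) := by
  have hx0 : 0 < x := by linarith
  have hK := summable_norm_sincSqKernelC_sub z
  have hb : ∀ n : ℤ, ‖(debyeCorr x n : ℂ) * sincSqKernelC (z - n)‖ ≤ 100 / x * ‖sincSqKernelC (z - n)‖ := by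
    intro n
    rw [norm_mul, Complex.norm_real, Real.norm_eq_abs]
    exact mul_le_mul_of_nonneg_right (abs_debyeCorr_le hx n) (norm_nonneg _)
  have hs : Summable fun n : ℤ => ‖(debyeCorr x n : ℂ) * sincSqKernelC (z - n)‖ :=
    Summable.of_nonneg_of_le (fun n => norm_nonneg _) hb (hK.mul_left _)
  have he2 : Real.exp 2 ≤ 7.5 := by
    have h := Real.exp_one_lt_d9
    have h2 : Real.exp 2 = Real.exp 1 ^ 2 := by rw [← Real.exp_nat_mul]; norm_num
    rw [h2]; nlinarith [Real.exp_pos 1]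
  unfold debyeLogEC
  calc ‖∑' n : ℤ, (debyeCorr x n : ℂ) * sincSqKernelC (z - n)‖
      ≤ ∑' n : ℤ, ‖(debyeCorr x n : ℂ) * sincSqKernelC (z - n)‖ := norm_tsum_le_tsum_norm hs
    _ ≤ ∑' n : ℤ, 100 / x * ‖sincSqKernelC (z - n)‖ := Summable.tsum_le_tsum hb hs (hK.mul_left _)
    _ = 100 / x * ∑' n : ℤ, ‖sincSqKernelC (z - n)‖ := tsum_mul_left
    _ ≤ 100 / x * (Real.exp 2 * Real.exp (2 * π * |z.im|) * (7 / 3)) := by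
        gcongr; exact tsum_norm_sincSqKernelC_sub_le z
    _ ≤ 100 / x * (7.5 * Real.exp (2 * π * |z.im|) * (7 / 3)) := by gcongr
    _ = 1750 / x * Real.exp (2 * π * |z.im|) := by ring
    _ ≤ 1800 / x * Real.exp (2 * π * |z.im|) := by gcongr; norm_num

/-- On the disc `‖z‖ < R` the complex kernel translates are dominated by the window sequence:
`‖K(z - n)‖ ≤ e² e^{2πR} · w_R(n)`. [folklore] -/
theorem norm_sincSqKernelC_sub_le_window {R : ℝ} {z : ℂ} (hz : ‖z‖ < R) (n : ℤ) :
    ‖sincSqKernelC (z - n)‖ ≤ Real.exp 2 * Real.exp (2 * π * R) *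
      (if |(n : ℝ)| ≤ 2 * R + 2 then (1 : ℝ) else 4 / (π ^ 2 * (n : ℝ) ^ 2)) := by
  have him : |z.im| ≤ R := le_trans (Complex.abs_im_le_norm z) hz.le
  have hre : |z.re| ≤ R := le_trans (Complex.abs_re_le_norm z) hz.le
  have hzim : (z - (n : ℂ)).im = z.im := by simp
  have hzre : (z - (n : ℂ)).re = z.re - n := by simp
  have hexp : Real.exp (2 * π * |(z - n).im|) ≤ Real.exp (2 * π * R) := by
    apply Real.exp_le_exp.2
    rw [hzim]
    gcongr
  have h1 : 1 ≤ Real.exp 2 := Real.one_le_exp (by norm_num)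
  split_ifs with h
  · calc ‖sincSqKernelC (z - n)‖ ≤ Real.exp 2 * Real.exp (2 * π * |(z - n).im|) :=
        norm_sincSqKernelC_le _
      _ ≤ Real.exp 2 * Real.exp (2 * π * R) * 1 := by rw [mul_one]; gcongr
  · push Not at h
    have hφn : |(n : ℝ)| / 2 ≤ |z.re - n| := by
      rw [abs_le] at hre
      rcases le_or_gt 0 (n : ℝ) with hn0 | hn0
      · rw [abs_of_nonneg hn0] at h ⊢
        rw [abs_sub_comm, abs_of_nonneg (by linarith)]
        linarith
      · rw [abs_of_neg hn0] at h ⊢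
        rw [abs_of_nonneg (by linarith)]
        linarith
    have hn0 : (n : ℝ) ≠ 0 := by
      intro h0; rw [h0, abs_zero] at h; linarith [norm_nonneg z]
    have hne : (z - (n : ℂ)).re ≠ 0 := by
      rw [hzre]
      intro h0; rw [h0, abs_zero] at hφn
      have : |(n : ℝ)| ≤ 0 := by linarith
      exact hn0 (abs_nonpos_iff.1 this)
    have h4 : (n : ℝ) ^ 2 ≤ 4 * (z.re - n) ^ 2 := by
      rw [← sq_abs (n : ℝ), ← sq_abs (z.re - n)]
      nlinarith [abs_nonneg (n : ℝ), abs_nonneg (z.re - n)]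
    have hπ : 0 < π ^ 2 := by positivity
    have hn2 : 0 < (n : ℝ) ^ 2 := by positivity
    calc ‖sincSqKernelC (z - n)‖
        ≤ Real.exp (2 * π * |(z - n).im|) / (π ^ 2 * (z - (n : ℂ)).re ^ 2) :=
          norm_sincSqKernelC_le_div_re hne
      _ ≤ Real.exp (2 * π * R) / (π ^ 2 * (z - (n : ℂ)).re ^ 2) := by gcongr
      _ = Real.exp (2 * π * R) / (π ^ 2 * (z.re - n) ^ 2) := by rw [hzre]
      _ ≤ Real.exp (2 * π * R) / (π ^ 2 * ((n : ℝ) ^ 2 / 4)) := by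
          apply div_le_div_of_nonneg_left (Real.exp_pos _).le (by positivity)
          apply mul_le_mul_of_nonneg_left _ hπ.le
          linarith
      _ = 1 * Real.exp (2 * π * R) * (4 / (π ^ 2 * (n : ℝ) ^ 2)) := by
          field_simp
      _ ≤ Real.exp 2 * Real.exp (2 * π * R) * (4 / (π ^ 2 * (n : ℝ) ^ 2)) := by gcongr

/-- `log E_x` is entire (`x > 0`): locally uniform convergence on every disc. [folklore] -/
theorem differentiable_debyeLogEC {x : ℝ} (hx : 0 < x) : Differentiable ℂ (debyeLogEC x) := by
  obtain ⟨M, hM⟩ := exists_forall_abs_debyeCorr_le hx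
  have hM0 : 0 ≤ M := le_trans (abs_nonneg _) (hM 0)
  -- differentiable on every disc `‖z‖ < R`
  have hR : ∀ R : ℝ, 0 < R → DifferentiableOn ℂ (debyeLogEC x) (Metric.ball 0 R) := by
    intro R hR
    set C := M * (Real.exp 2 * Real.exp (2 * π * R)) with hC
    set u : ℤ → ℝ := fun n => C * (if |(n : ℝ)| ≤ 2 * R + 2 then (1 : ℝ) else 4 / (π ^ 2 * (n : ℝ) ^ 2))
      with hu
    have hu_sum : Summable u := (summable_windowBound R).mul_left C
    apply differentiableOn_tsum_of_summable_norm hu_sum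
    · intro n
      exact ((differentiable_const _).mul
        (differentiable_sincSqKernelC.comp (differentiable_id.sub (differentiable_const _)))).differentiableOn
    · exact Metric.isOpen_ball
    · intro n z hz
      rw [Metric.mem_ball, dist_zero_right] at hz
      rw [norm_mul, Complex.norm_real, Real.norm_eq_abs, hu, hC]
      dsimp only
      rw [mul_assoc]
      exact mul_le_mul (hM n) (norm_sincSqKernelC_sub_le_window hz n) (norm_nonneg _) hM0
  intro z
  have hz : z ∈ Metric.ball (0 : ℂ) (‖z‖ + 1) := by
    rw [Metric.mem_ball, dist_zero_right]; linarith
  exact (hR (‖z‖ + 1) (by positivity)).differentiableAt (Metric.isOpen_ball.mem_nhds hz)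

/-! ### The complex Debye exponent

On the strip `|Im w| < 1` we have `Re(1 + w²) = 1 + (Re w)² - (Im w)² > 0`, so the principal
square root `R(w) = √(1+w²)`, the inverse hyperbolic sine `A(w) = log(w + R(w))` and the Debye
exponent `g(w) = R(w) - w A(w)` are analytic there, with `R' = w/R`, `A' = 1/R`, `g' = -A`,
`g'' = -1/R`; and `G_x(z) = x g(z/x) - ¼ log(1 + (z/x)²) - ½ log(2πx)` (`= log L_x(z)` on the real
axis) is analytic on `|Im z| < x`. [cite: FrohlichSpencerKT1981, Appendix B, (B.12)–(B.13), p. 599] -/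

/-- `Re(1 + w²) = 1 + (Re w)² - (Im w)²`. [folklore] -/
theorem one_add_sq_re (w : ℂ) : (1 + w ^ 2).re = 1 + w.re ^ 2 - w.im ^ 2 := by
  simp [sq, Complex.mul_re]
  ring

/-- On the strip `|Im w| < 1`, `Re(1 + w²) > 0`. [folklore] -/
theorem one_add_sq_re_pos {w : ℂ} (hw : |w.im| < 1) : 0 < (1 + w ^ 2).re := by
  rw [one_add_sq_re]
  have : w.im ^ 2 < 1 := by
    rw [← sq_abs]; nlinarith [abs_nonneg w.im]
  nlinarith [sq_nonneg w.re]

/-- `1 + w² ≠ 0` and `1 + w² ∈ slitPlane` on the strip. [folklore] -/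
theorem one_add_sq_mem_slitPlane {w : ℂ} (hw : |w.im| < 1) : 1 + w ^ 2 ∈ Complex.slitPlane :=
  Complex.mem_slitPlane_iff.2 (Or.inl (one_add_sq_re_pos hw))

/-- `1 + w² ≠ 0` on the strip. [folklore] -/
theorem one_add_sq_ne_zero {w : ℂ} (hw : |w.im| < 1) : 1 + w ^ 2 ≠ 0 :=
  Complex.slitPlane_ne_zero (one_add_sq_mem_slitPlane hw)

/-- The principal square root `R(w) = √(1 + w²) = exp(½ log(1 + w²))`. [folklore] -/
def debyeR (w : ℂ) : ℂ := Complex.exp (Complex.log (1 + w ^ 2) / 2)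

/-- `R(w)² = 1 + w²`. [folklore] -/
theorem debyeR_sq {w : ℂ} (hw : |w.im| < 1) : debyeR w ^ 2 = 1 + w ^ 2 := by
  unfold debyeR
  rw [sq, ← Complex.exp_add, add_halves, Complex.exp_log (one_add_sq_ne_zero hw)]

/-- `R(w) ≠ 0`. [folklore] -/
theorem debyeR_ne_zero (w : ℂ) : debyeR w ≠ 0 := Complex.exp_ne_zero _

/-- `Re R(w) > 0` on the strip (the argument of `1 + w²` lies in `(-π/2, π/2)`). [folklore] -/
theorem debyeR_re_pos {w : ℂ} (hw : |w.im| < 1) : 0 < (debyeR w).re := by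
  unfold debyeR
  rw [Complex.exp_re]
  apply mul_pos (Real.exp_pos _)
  apply Real.cos_pos_of_mem_Ioo
  have harg : |(1 + w ^ 2).arg| < π / 2 :=
    Complex.abs_arg_lt_pi_div_two_iff.2 (Or.inl (one_add_sq_re_pos hw))
  have him : (Complex.log (1 + w ^ 2) / 2).im = (1 + w ^ 2).arg / 2 := by
    rw [Complex.div_ofNat_im, Complex.log_im]
  rw [him, Set.mem_Ioo]
  rw [abs_lt] at harg
  constructor <;> linarith

/-- `‖R(w)‖² = ‖1 + w²‖`. [folklore] -/
theorem norm_debyeR_sq {w : ℂ} (hw : |w.im| < 1) : ‖debyeR w‖ ^ 2 = ‖1 + w ^ 2‖ := by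
  rw [← norm_pow, debyeR_sq hw]

/-- `Re(w + R(w)) > 0` on the strip (for `Re w < 0` use `w + R = (R - w)⁻¹`). [folklore] -/
theorem add_debyeR_re_pos {w : ℂ} (hw : |w.im| < 1) : 0 < (w + debyeR w).re := by
  have hR := debyeR_re_pos hw
  rcases le_or_gt 0 w.re with h | h
  · rw [Complex.add_re]; linarith
  · -- `(w + R)(R - w) = R² - w² = 1`
    have hprod : (w + debyeR w) * (debyeR w - w) = 1 := by
      have := debyeR_sq hw
      linear_combination this
    have hne : debyeR w - w ≠ 0 := by
      intro h0; rw [h0, mul_zero] at hprod; exact zero_ne_one hprod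
    have heq : w + debyeR w = (debyeR w - w)⁻¹ := eq_inv_of_mul_eq_one_left hprod
    rw [heq, Complex.inv_re]
    apply div_pos
    · rw [Complex.sub_re]; linarith
    · exact Complex.normSq_pos.2 hne

/-- `w + R(w)` lies in the slit plane. [folklore] -/
theorem add_debyeR_mem_slitPlane {w : ℂ} (hw : |w.im| < 1) : w + debyeR w ∈ Complex.slitPlane :=
  Complex.mem_slitPlane_iff.2 (Or.inl (add_debyeR_re_pos hw))

/-- `w + R(w) ≠ 0`. [folklore] -/
theorem add_debyeR_ne_zero {w : ℂ} (hw : |w.im| < 1) : w + debyeR w ≠ 0 :=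
  Complex.slitPlane_ne_zero (add_debyeR_mem_slitPlane hw)

/-- The complex inverse hyperbolic sine `A(w) = log(w + √(1+w²))` on the strip. [folklore] -/
def debyeA (w : ℂ) : ℂ := Complex.log (w + debyeR w)

/-- The complex Debye exponent `g(w) = √(1+w²) - w sinh⁻¹ w`. [cite: FrohlichSpencerKT1981, Appendix B, (B.12), p. 599] -/
def debyeg (w : ℂ) : ℂ := debyeR w - w * debyeA w

/-- `R' = w/R`. [folklore] -/
theorem hasDerivAt_debyeR {w : ℂ} (hw : |w.im| < 1) : HasDerivAt debyeR (w / debyeR w) w := by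
  have hq : HasDerivAt (fun w : ℂ => 1 + w ^ 2) (2 * w) w := by
    simpa using ((hasDerivAt_pow 2 w).const_add 1)
  have hlog := hq.clog (one_add_sq_mem_slitPlane hw)
  have h := (hlog.div_const 2).cexp
  unfold debyeR
  refine h.congr_deriv ?_
  have hR : Complex.exp (Complex.log (1 + w ^ 2) / 2) ^ 2 = 1 + w ^ 2 := debyeR_sq hw
  set E := Complex.exp (Complex.log (1 + w ^ 2) / 2) with hE
  have hne : E ≠ 0 := Complex.exp_ne_zero _
  rw [← hR]
  field_simp

/-- `A' = 1/R`. [folklore] -/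
theorem hasDerivAt_debyeA {w : ℂ} (hw : |w.im| < 1) : HasDerivAt debyeA (1 / debyeR w) w := by
  have h1 : HasDerivAt (fun w : ℂ => w + debyeR w) (1 + w / debyeR w) w :=
    (hasDerivAt_id w).add (hasDerivAt_debyeR hw)
  have h := h1.clog (add_debyeR_mem_slitPlane hw)
  unfold debyeA
  refine h.congr_deriv ?_
  have hR : debyeR w ≠ 0 := debyeR_ne_zero w
  have hwR : w + debyeR w ≠ 0 := add_debyeR_ne_zero hw
  field_simp
  ring

/-- `g' = -A`. [folklore] -/
theorem hasDerivAt_debyeg {w : ℂ} (hw : |w.im| < 1) : HasDerivAt debyeg (-debyeA w) w := by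
  have h := (hasDerivAt_debyeR hw).sub ((hasDerivAt_id w).mul (hasDerivAt_debyeA hw))
  unfold debyeg
  refine h.congr_deriv ?_
  have hR : debyeR w ≠ 0 := debyeR_ne_zero w
  simp only [id]
  field_simp
  ring

/-- `(log(1 + w²))' = 2w/(1 + w²)`. [folklore] -/
theorem hasDerivAt_log_one_add_sq {w : ℂ} (hw : |w.im| < 1) :
    HasDerivAt (fun w : ℂ => Complex.log (1 + w ^ 2)) (2 * w / (1 + w ^ 2)) w := by
  have hq : HasDerivAt (fun w : ℂ => 1 + w ^ 2) (2 * w) w := by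
    simpa using ((hasDerivAt_pow 2 w).const_add 1)
  exact hq.clog (one_add_sq_mem_slitPlane hw)

/-- `(w/(1 + w²))' = (1 - w²)/(1 + w²)²`. [folklore] -/
theorem hasDerivAt_div_one_add_sq {w : ℂ} (hw : |w.im| < 1) :
    HasDerivAt (fun w : ℂ => w / (1 + w ^ 2)) ((1 - w ^ 2) / (1 + w ^ 2) ^ 2) w := by
  have hq : HasDerivAt (fun w : ℂ => 1 + w ^ 2) (2 * w) w := by
    simpa using ((hasDerivAt_pow 2 w).const_add 1)
  have h := (hasDerivAt_id w).div hq (one_add_sq_ne_zero hw)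
  refine h.congr_deriv ?_
  simp only [id]
  ring

/-! ### On the real axis -/

/-- `R(w) = √(1 + w²)` for real `w`. [folklore] -/
theorem debyeR_ofReal (w : ℝ) : debyeR w = (√(1 + w ^ 2) : ℝ) := by
  unfold debyeR
  have hq : (0 : ℝ) < 1 + w ^ 2 := by positivity
  rw [show (1 : ℂ) + (w : ℂ) ^ 2 = ((1 + w ^ 2 : ℝ) : ℂ) by push_cast; ring,
    ← Complex.ofReal_log hq.le, show ((Real.log (1 + w ^ 2) : ℝ) : ℂ) / 2 =
      ((Real.log (1 + w ^ 2) / 2 : ℝ) : ℂ) by push_cast; ring, ← Complex.ofReal_exp]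
  congr 1
  rw [eq_comm, Real.sqrt_eq_iff_mul_self_eq hq.le (Real.exp_pos _).le, ← Real.exp_add, add_halves,
    Real.exp_log hq]

/-- `A(w) = sinh⁻¹ w` for real `w`. [folklore] -/
theorem debyeA_ofReal (w : ℝ) : debyeA w = (Real.arsinh w : ℝ) := by
  unfold debyeA
  rw [debyeR_ofReal, Real.arsinh]
  have hpos : 0 < w + √(1 + w ^ 2) := by
    have h1 : |w| < √(1 + w ^ 2) := by
      rw [← Real.sqrt_sq_eq_abs]
      exact Real.sqrt_lt_sqrt (sq_nonneg _) (by linarith)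
    cases abs_lt.1 h1
    linarith
  rw [Complex.ofReal_log hpos.le]
  push_cast
  ring_nf

/-- `g(w) = √(1+w²) - w sinh⁻¹ w` for real `w`. [folklore] -/
theorem debyeg_ofReal (w : ℝ) : debyeg w = ((√(1 + w ^ 2) - w * Real.arsinh w : ℝ) : ℂ) := by
  unfold debyeg
  rw [debyeA_ofReal, debyeR_ofReal]
  push_cast
  ring

/-! ### `G_x = log L_x` on the strip `|Im z| < x` -/

/-- `G_x(z) = x g(z/x) - ¼ log(1 + (z/x)²) - ½ log(2πx)`, the analytic continuation of `log L_x`.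
[cite: FrohlichSpencerKT1981, Appendix B, (B.12)–(B.13), p. 599] -/
def debyeG (x : ℝ) (z : ℂ) : ℂ :=
  x * debyeg (z / x) - Complex.log (1 + (z / x) ^ 2) / 4 - ((Real.log (2 * π * x) / 2 : ℝ) : ℂ)

/-- `G_x'(z) = -A(z/x) - (z/x)/((1 + (z/x)²) 2x)`. [folklore] -/
def debyeG' (x : ℝ) (z : ℂ) : ℂ := -debyeA (z / x) - (z / x) / (1 + (z / x) ^ 2) / (2 * x)

/-- `G_x''(z) = -1/(x R(z/x)) - (1 - (z/x)²)/((1 + (z/x)²)² 2x²)`. [folklore] -/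
def debyeG'' (x : ℝ) (z : ℂ) : ℂ :=
  -(1 / debyeR (z / x)) / x - (1 - (z / x) ^ 2) / (1 + (z / x) ^ 2) ^ 2 / (2 * x ^ 2)

/-- Scaling the strip: `|Im(z/x)| < 1` iff `|Im z| < x` (`x > 0`). [folklore] -/
theorem abs_im_div_lt_one {x : ℝ} (hx : 0 < x) {z : ℂ} (hz : |z.im| < x) : |(z / x).im| < 1 := by
  rw [Complex.div_ofReal_im, abs_div, abs_of_pos hx, div_lt_one hx]
  exact hz

/-- `G_x` is complex differentiable on the strip `|Im z| < x`, with derivative `G_x'`. [folklore] -/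
theorem hasDerivAt_debyeG {x : ℝ} (hx : 0 < x) {z : ℂ} (hz : |z.im| < x) :
    HasDerivAt (debyeG x) (debyeG' x z) z := by
  have hw := abs_im_div_lt_one hx hz
  have hdiv : HasDerivAt (fun z : ℂ => z / x) (1 / x) z := by
    simpa using (hasDerivAt_id z).div_const (x : ℂ)
  have h1 : HasDerivAt (fun z : ℂ => debyeg (z / x)) (-debyeA (z / x) * (1 / x)) z := by
    have := HasDerivAt.comp z (hasDerivAt_debyeg hw) hdiv
    exact this
  have h2 : HasDerivAt (fun z : ℂ => Complex.log (1 + (z / x) ^ 2))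
      (2 * (z / x) / (1 + (z / x) ^ 2) * (1 / x)) z := by
    have := HasDerivAt.comp z (hasDerivAt_log_one_add_sq hw) hdiv
    exact this
  have h := ((h1.const_mul (x : ℂ)).sub (h2.div_const 4)).sub_const
    (((Real.log (2 * π * x) / 2 : ℝ) : ℂ))
  unfold debyeG debyeG'
  refine h.congr_deriv ?_
  have hx0 : (x : ℂ) ≠ 0 := by exact_mod_cast hx.ne'
  field_simp
  ring

/-- `G_x'` is complex differentiable on the strip, with derivative `G_x''`. [folklore] -/
theorem hasDerivAt_debyeG' {x : ℝ} (hx : 0 < x) {z : ℂ} (hz : |z.im| < x) :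
    HasDerivAt (debyeG' x) (debyeG'' x z) z := by
  have hw := abs_im_div_lt_one hx hz
  have hdiv : HasDerivAt (fun z : ℂ => z / x) (1 / x) z := by
    simpa using (hasDerivAt_id z).div_const (x : ℂ)
  have h1 : HasDerivAt (fun z : ℂ => debyeA (z / x)) (1 / debyeR (z / x) * (1 / x)) z := by
    have := HasDerivAt.comp z (hasDerivAt_debyeA hw) hdiv
    exact this
  have h2 : HasDerivAt (fun z : ℂ => (z / x) / (1 + (z / x) ^ 2))
      ((1 - (z / x) ^ 2) / (1 + (z / x) ^ 2) ^ 2 * (1 / x)) z := by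
    have := HasDerivAt.comp z (hasDerivAt_div_one_add_sq hw) hdiv
    exact this
  have h := h1.neg.sub (h2.div_const (2 * (x : ℂ)))
  unfold debyeG' debyeG''
  refine h.congr_deriv ?_
  have hx0 : (x : ℂ) ≠ 0 := by exact_mod_cast hx.ne'
  field_simp

/-- `G_x` is differentiable on the open strip `|Im z| < x`. [folklore] -/
theorem differentiableOn_debyeG {x : ℝ} (hx : 0 < x) :
    DifferentiableOn ℂ (debyeG x) {z : ℂ | |z.im| < x} := fun _ hz =>
  (hasDerivAt_debyeG hx hz).differentiableAt.differentiableWithinAt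

/-- On the real axis `G_x = log L_x`. [cite: FrohlichSpencerKT1981, Appendix B, (B.12), p. 599] -/
theorem debyeG_ofReal {x : ℝ} (hx : 0 < x) (φ : ℝ) : debyeG x φ = (Real.log (debyeL x φ) : ℝ) := by
  have hq : (0 : ℝ) < 1 + (φ / x) ^ 2 := by positivity
  -- Step 1: `G_x(φ)` is the cast of a real expression
  have hcast : debyeG x φ = ((x * (√(1 + (φ / x) ^ 2) - (φ / x) * Real.arsinh (φ / x)) -
      Real.log (1 + (φ / x) ^ 2) / 4 - Real.log (2 * π * x) / 2 : ℝ) : ℂ) := by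
    unfold debyeG
    have hw : ((φ : ℂ) / x) = ((φ / x : ℝ) : ℂ) := by push_cast; ring
    rw [hw, debyeg_ofReal, show (1 : ℂ) + ((φ / x : ℝ) : ℂ) ^ 2 = ((1 + (φ / x) ^ 2 : ℝ) : ℂ) by
      push_cast; ring, ← Complex.ofReal_log hq.le]
    push_cast
    ring
  -- Step 2: the real identity
  have hs : √(x ^ 2 + φ ^ 2) = x * √(1 + (φ / x) ^ 2) := by
    rw [show x ^ 2 + φ ^ 2 = x ^ 2 * (1 + (φ / x) ^ 2) by field_simp, Real.sqrt_mul (sq_nonneg x),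
      Real.sqrt_sq hx.le]
  have hsq : 0 < √(1 + (φ / x) ^ 2) := Real.sqrt_pos.2 hq
  have hlog : Real.log (2 * π * √(x ^ 2 + φ ^ 2)) =
      Real.log (2 * π * x) + Real.log (1 + (φ / x) ^ 2) / 2 := by
    rw [hs, show 2 * π * (x * √(1 + (φ / x) ^ 2)) = (2 * π * x) * √(1 + (φ / x) ^ 2) by ring,
      Real.log_mul (by positivity) hsq.ne', Real.log_sqrt hq.le]
  have hreal : x * (√(1 + (φ / x) ^ 2) - (φ / x) * Real.arsinh (φ / x)) -
      Real.log (1 + (φ / x) ^ 2) / 4 - Real.log (2 * π * x) / 2 =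
      √(x ^ 2 + φ ^ 2) - φ * Real.arsinh (φ / x) - Real.log (2 * π * √(x ^ 2 + φ ^ 2)) / 2 := by
    rw [hlog, hs]
    field_simp
    ring
  rw [hcast, hreal, log_debyeL hx]

/-- `G_x'` is real on the real axis. [folklore] -/
theorem debyeG'_ofReal_im (x : ℝ) (φ : ℝ) : (debyeG' x φ).im = 0 := by
  unfold debyeG'
  have hw : ((φ : ℂ) / x) = ((φ / x : ℝ) : ℂ) := by push_cast; ring
  rw [hw, debyeA_ofReal,
    show (1 : ℂ) + ((φ / x : ℝ) : ℂ) ^ 2 = ((1 + (φ / x) ^ 2 : ℝ) : ℂ) by push_cast; ring,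
    show (2 : ℂ) * x = ((2 * x : ℝ) : ℂ) by push_cast; ring]
  rw [← Complex.ofReal_div, ← Complex.ofReal_div, ← Complex.ofReal_neg, ← Complex.ofReal_sub,
    Complex.ofReal_im]

/-! ### The bound `‖G_x''‖ ≤ 2/x` on the strip `|Im z| ≤ 3x/4` -/

/-- On `|Im w| ≤ 3/4`: `‖1 + w²‖ ≥ 7/16`. [folklore] -/
theorem norm_one_add_sq_ge {w : ℂ} (hw : |w.im| ≤ 3 / 4) : 7 / 16 ≤ ‖1 + w ^ 2‖ := by
  have h1 : 7 / 16 ≤ (1 + w ^ 2).re := by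
    rw [one_add_sq_re]
    have : w.im ^ 2 ≤ 9 / 16 := by
      rw [← sq_abs]; nlinarith [abs_nonneg w.im]
    nlinarith [sq_nonneg w.re]
  exact h1.trans (Complex.re_le_norm _)

/-- `‖G_x''(z)‖ ≤ 2/x` for `x ≥ 100` and `|Im z| ≤ 3x/4`. [folklore] -/
theorem norm_debyeG''_le {x : ℝ} (hx : 100 ≤ x) {z : ℂ} (hz : |z.im| ≤ 3 / 4 * x) :
    ‖debyeG'' x z‖ ≤ 2 / x := by
  have hx0 : 0 < x := by linarith
  set w := z / (x : ℂ) with hw_def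
  have hwim : |w.im| ≤ 3 / 4 := by
    rw [hw_def, Complex.div_ofReal_im, abs_div, abs_of_pos hx0, div_le_iff₀ hx0]
    exact hz
  have hwim' : |w.im| < 1 := by linarith
  have hq := norm_one_add_sq_ge hwim
  have hq0 : 0 < ‖1 + w ^ 2‖ := by linarith
  -- ‖1/R‖ ≤ 8/5
  have hR : ‖1 / debyeR w‖ ≤ 8 / 5 := by
    have h1 : ‖1 / debyeR w‖ ^ 2 = 1 / ‖1 + w ^ 2‖ := by
      rw [norm_div, norm_one, div_pow, one_pow, norm_debyeR_sq hwim']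
    have h2 : ‖1 / debyeR w‖ ^ 2 ≤ (8 / 5) ^ 2 := by
      rw [h1, div_le_iff₀ hq0]
      nlinarith
    exact (pow_le_pow_iff_left₀ (norm_nonneg _) (by norm_num) two_ne_zero).1 h2
  -- ‖(1 - w²)/(1 + w²)²‖ ≤ 13
  have hT : ‖(1 - w ^ 2) / (1 + w ^ 2) ^ 2‖ ≤ 13 := by
    have h1 : ‖1 - w ^ 2‖ ≤ 2 + ‖1 + w ^ 2‖ := by
      calc ‖1 - w ^ 2‖ = ‖2 - (1 + w ^ 2)‖ := by ring_nf
        _ ≤ ‖(2 : ℂ)‖ + ‖1 + w ^ 2‖ := norm_sub_le _ _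
        _ = 2 + ‖1 + w ^ 2‖ := by norm_num
    rw [norm_div, norm_pow, div_le_iff₀ (by positivity)]
    nlinarith [hq, h1, norm_nonneg (1 + w ^ 2)]
  have hn1 : ‖-(1 / debyeR w) / (x : ℂ)‖ = ‖1 / debyeR w‖ / x := by
    rw [norm_div _ (x : ℂ), norm_neg, Complex.norm_real, Real.norm_eq_abs, abs_of_pos hx0]
  have hn2 : ‖(1 - w ^ 2) / (1 + w ^ 2) ^ 2 / (2 * (x : ℂ) ^ 2)‖ =
      ‖(1 - w ^ 2) / (1 + w ^ 2) ^ 2‖ / (2 * x ^ 2) := by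
    rw [show (2 : ℂ) * (x : ℂ) ^ 2 = ((2 * x ^ 2 : ℝ) : ℂ) by push_cast; ring,
      norm_div _ (((2 * x ^ 2 : ℝ)) : ℂ), Complex.norm_real, Real.norm_eq_abs,
      abs_of_pos (by positivity)]
  unfold debyeG''
  rw [← hw_def]
  calc ‖-(1 / debyeR w) / x - (1 - w ^ 2) / (1 + w ^ 2) ^ 2 / (2 * x ^ 2)‖
      ≤ ‖-(1 / debyeR w) / x‖ + ‖(1 - w ^ 2) / (1 + w ^ 2) ^ 2 / (2 * x ^ 2)‖ := norm_sub_le _ _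
    _ = ‖1 / debyeR w‖ / x + ‖(1 - w ^ 2) / (1 + w ^ 2) ^ 2‖ / (2 * x ^ 2) := by rw [hn1, hn2]
    _ ≤ (8 / 5) / x + 13 / (2 * x ^ 2) := by gcongr
    _ ≤ 2 / x := by
        rw [div_add_div _ _ hx0.ne' (by positivity), div_le_div_iff₀ (by positivity) hx0]
        nlinarith

/-! ### Calculus along vertical segments

Generic lemmas for a complex function `f` along the path `v ↦ φ + iv`: the derivative of
`v ↦ f(φ + iv)` is `i f'(φ + iv)`; a bound `‖f'‖ ≤ K` gives `‖f(φ + ia) - f(φ)‖ ≤ K|a|` (first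
order), and a bound `‖f''‖ ≤ K` together with `f'(φ) ∈ ℝ` gives
`|Re f(φ + ia) - Re f(φ)| ≤ K a²/2` (second order: the first-order term `ia f'(φ)` is purely
imaginary). These are the "Taylor's theorem" steps of [FS81, (B.13) and p. 599]. -/

/-- The vertical path `v ↦ φ + iv` has derivative `i`. [folklore] -/
theorem hasDerivAt_vertical (φ : ℂ) (v : ℝ) : HasDerivAt (fun v : ℝ => φ + (v : ℂ) * I) I v := by
  have h := (Complex.ofRealCLM.hasDerivAt (x := v)).mul_const I
  simp only [Complex.ofRealCLM_apply, Complex.ofReal_one, one_mul] at h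
  exact h.const_add φ

/-- Chain rule along the vertical path: `d/dv f(φ + iv) = f'(φ + iv) · i`. [folklore] -/
theorem hasDerivAt_comp_vertical {f : ℂ → ℂ} {f' : ℂ} {φ : ℂ} {v : ℝ}
    (hf : HasDerivAt f f' (φ + (v : ℂ) * I)) :
    HasDerivAt (fun v : ℝ => f (φ + (v : ℂ) * I)) (f' * I) v := by
  have := HasDerivAt.comp v hf (hasDerivAt_vertical φ v)
  exact this

/-- **First order**: if `‖f'‖ ≤ K` on the vertical segment from `φ` to `φ + ia`, then
`‖f(φ + ia) - f(φ)‖ ≤ K |a|`. [folklore] -/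
theorem norm_sub_le_of_vertical {f f' : ℂ → ℂ} {φ : ℂ} {a K : ℝ}
    (hf : ∀ v : ℝ, |v| ≤ |a| → HasDerivAt f (f' (φ + (v : ℂ) * I)) (φ + (v : ℂ) * I))
    (hK : ∀ v : ℝ, |v| ≤ |a| → ‖f' (φ + (v : ℂ) * I)‖ ≤ K) :
    ‖f (φ + (a : ℂ) * I) - f φ‖ ≤ K * |a| := by
  set g : ℝ → ℂ := fun v => f (φ + (v : ℂ) * I) with hg
  have hseg : ∀ v ∈ Set.Icc (-|a|) |a|, HasDerivWithinAt g (f' (φ + (v : ℂ) * I) * I) (Set.Icc (-|a|) |a|) v :=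
    fun v hv => (hasDerivAt_comp_vertical (hf v (abs_le.2 hv))).hasDerivWithinAt
  have hbound : ∀ v ∈ Set.Icc (-|a|) |a|, ‖f' (φ + (v : ℂ) * I) * I‖ ≤ K := fun v hv => by
    rw [norm_mul, Complex.norm_I, mul_one]; exact hK v (abs_le.2 hv)
  have h := Convex.norm_image_sub_le_of_norm_hasDerivWithin_le hseg hbound (convex_Icc _ _)
    (show (0 : ℝ) ∈ Set.Icc (-|a|) |a| by constructor <;> linarith [abs_nonneg a])
    (show a ∈ Set.Icc (-|a|) |a| from ⟨neg_abs_le a, le_abs_self a⟩)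
  simp only [hg, Complex.ofReal_zero, zero_mul, add_zero, sub_zero] at h
  rwa [Real.norm_eq_abs] at h

/-- A real function with `|g'(v)| ≤ K|v|` between `0` and `a` satisfies `|g(a) - g(0)| ≤ Ka²/2`.
[folklore] -/
theorem abs_sub_le_of_abs_deriv_le_mul {g g' : ℝ → ℝ} {a K : ℝ}
    (hg : ∀ v : ℝ, |v| ≤ |a| → HasDerivAt g (g' v) v) (hK : ∀ v : ℝ, |v| ≤ |a| → |g' v| ≤ K * |v|) :
    |g a - g 0| ≤ K * a ^ 2 / 2 := by
  have hdiff : ∀ v : ℝ, |v| ≤ |a| → DifferentiableAt ℝ g v := fun v hv => (hg v hv).differentiableAt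
  -- the two auxiliary functions `K v²/2 ∓ (g v - g 0)`
  set P : ℝ → ℝ := fun v => K * v ^ 2 / 2 - (g v - g 0) with hP
  set Q : ℝ → ℝ := fun v => K * v ^ 2 / 2 + (g v - g 0) with hQ
  have hPd : ∀ v : ℝ, |v| ≤ |a| → HasDerivAt P (K * v - g' v) v := fun v hv => by
    have h1 : HasDerivAt (fun v : ℝ => K * v ^ 2 / 2) (K * v) v := by
      have := ((hasDerivAt_pow 2 v).const_mul K).div_const 2
      refine this.congr_deriv ?_
      simp only [Nat.cast_ofNat, Nat.add_one_sub_one, pow_one]; ring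
    exact h1.sub ((hg v hv).sub_const _)
  have hQd : ∀ v : ℝ, |v| ≤ |a| → HasDerivAt Q (K * v + g' v) v := fun v hv => by
    have h1 : HasDerivAt (fun v : ℝ => K * v ^ 2 / 2) (K * v) v := by
      have := ((hasDerivAt_pow 2 v).const_mul K).div_const 2
      refine this.congr_deriv ?_
      simp only [Nat.cast_ofNat, Nat.add_one_sub_one, pow_one]; ring
    exact h1.add ((hg v hv).sub_const _)
  have hP0 : P 0 = 0 := by simp [hP]
  have hQ0 : Q 0 = 0 := by simp [hQ]
  rcases le_or_gt 0 a with ha | ha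
  · -- on `[0, a]`: `P` and `Q` are monotone
    have habs : |a| = a := abs_of_nonneg ha
    have hmem : ∀ v ∈ Set.Icc 0 a, |v| ≤ |a| := fun v hv => by
      rw [habs, abs_of_nonneg hv.1]; exact hv.2
    have hPm : MonotoneOn P (Set.Icc 0 a) := by
      apply monotoneOn_of_deriv_nonneg (convex_Icc 0 a)
      · exact fun v hv => (hPd v (hmem v hv)).continuousAt.continuousWithinAt
      · intro v hv
        exact (hPd v (hmem v (interior_subset hv))).differentiableAt.differentiableWithinAt
      · intro v hv
        rw [interior_Icc] at hv
        rw [(hPd v (hmem v (Set.Ioo_subset_Icc_self hv))).deriv]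
        have := hK v (hmem v (Set.Ioo_subset_Icc_self hv))
        rw [abs_of_pos hv.1] at this
        linarith [(abs_le.1 this).2]
    have hQm : MonotoneOn Q (Set.Icc 0 a) := by
      apply monotoneOn_of_deriv_nonneg (convex_Icc 0 a)
      · exact fun v hv => (hQd v (hmem v hv)).continuousAt.continuousWithinAt
      · intro v hv
        exact (hQd v (hmem v (interior_subset hv))).differentiableAt.differentiableWithinAt
      · intro v hv
        rw [interior_Icc] at hv
        rw [(hQd v (hmem v (Set.Ioo_subset_Icc_self hv))).deriv]
        have := hK v (hmem v (Set.Ioo_subset_Icc_self hv))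
        rw [abs_of_pos hv.1] at this
        linarith [(abs_le.1 this).1]
    have h1 := hPm (Set.left_mem_Icc.2 ha) (Set.right_mem_Icc.2 ha) ha
    have h2 := hQm (Set.left_mem_Icc.2 ha) (Set.right_mem_Icc.2 ha) ha
    rw [hP0] at h1; rw [hQ0] at h2
    simp only [hP, hQ] at h1 h2
    rw [abs_le]; constructor <;> linarith
  · -- on `[a, 0]`: `P` and `Q` are antitone
    have habs : |a| = -a := abs_of_neg ha
    have hmem : ∀ v ∈ Set.Icc a 0, |v| ≤ |a| := fun v hv => by
      rw [habs, abs_of_nonpos hv.2]; linarith [hv.1]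
    have hPm : AntitoneOn P (Set.Icc a 0) := by
      apply antitoneOn_of_deriv_nonpos (convex_Icc a 0)
      · exact fun v hv => (hPd v (hmem v hv)).continuousAt.continuousWithinAt
      · intro v hv
        exact (hPd v (hmem v (interior_subset hv))).differentiableAt.differentiableWithinAt
      · intro v hv
        rw [interior_Icc] at hv
        rw [(hPd v (hmem v (Set.Ioo_subset_Icc_self hv))).deriv]
        have := hK v (hmem v (Set.Ioo_subset_Icc_self hv))
        rw [abs_of_neg hv.2] at this
        linarith [(abs_le.1 this).1]
    have hQm : AntitoneOn Q (Set.Icc a 0) := by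
      apply antitoneOn_of_deriv_nonpos (convex_Icc a 0)
      · exact fun v hv => (hQd v (hmem v hv)).continuousAt.continuousWithinAt
      · intro v hv
        exact (hQd v (hmem v (interior_subset hv))).differentiableAt.differentiableWithinAt
      · intro v hv
        rw [interior_Icc] at hv
        rw [(hQd v (hmem v (Set.Ioo_subset_Icc_self hv))).deriv]
        have := hK v (hmem v (Set.Ioo_subset_Icc_self hv))
        rw [abs_of_neg hv.2] at this
        linarith [(abs_le.1 this).2]
    have h1 := hPm (Set.left_mem_Icc.2 ha.le) (Set.right_mem_Icc.2 ha.le) ha.le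
    have h2 := hQm (Set.left_mem_Icc.2 ha.le) (Set.right_mem_Icc.2 ha.le) ha.le
    rw [hP0] at h1; rw [hQ0] at h2
    simp only [hP, hQ] at h1 h2
    rw [abs_le]; constructor <;> nlinarith

/-- **Second order**: if `f` has derivatives `f'`, `f''` along the vertical segment from `φ` to
`φ + ia`, `f'(φ)` is real and `‖f''‖ ≤ K` there, then `|Re f(φ + ia) - Re f(φ)| ≤ K a²/2`.
[cite: FrohlichSpencerKT1981, Appendix B, (B.13), p. 599] -/
theorem abs_re_sub_re_le_of_vertical {f f' f'' : ℂ → ℂ} {φ : ℂ} {a K : ℝ}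
    (hf : ∀ v : ℝ, |v| ≤ |a| → HasDerivAt f (f' (φ + (v : ℂ) * I)) (φ + (v : ℂ) * I))
    (hf' : ∀ v : ℝ, |v| ≤ |a| → HasDerivAt f' (f'' (φ + (v : ℂ) * I)) (φ + (v : ℂ) * I))
    (him : (f' φ).im = 0) (hK : ∀ v : ℝ, |v| ≤ |a| → ‖f'' (φ + (v : ℂ) * I)‖ ≤ K) :
    |(f (φ + (a : ℂ) * I)).re - (f φ).re| ≤ K * a ^ 2 / 2 := by
  -- γ(v) = Re f(φ+iv), γ'(v) = -Im f'(φ+iv), |γ'' | ≤ K, γ'(0) = 0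
  set γ : ℝ → ℝ := fun v => (f (φ + (v : ℂ) * I)).re with hγ
  set γ₁ : ℝ → ℝ := fun v => -(f' (φ + (v : ℂ) * I)).im with hγ₁
  have hγd : ∀ v : ℝ, |v| ≤ |a| → HasDerivAt γ (γ₁ v) v := fun v hv => by
    have h := Complex.reCLM.hasFDerivAt.comp_hasDerivAt v (hasDerivAt_comp_vertical (hf v hv))
    simp only [Complex.reCLM_apply, Complex.mul_I_re] at h
    exact h
  have hγ₁d : ∀ v : ℝ, |v| ≤ |a| → HasDerivAt γ₁ (-(f'' (φ + (v : ℂ) * I)).re) v := fun v hv => by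
    have h := Complex.imCLM.hasFDerivAt.comp_hasDerivAt v (hasDerivAt_comp_vertical (hf' v hv))
    simp only [Complex.imCLM_apply, Complex.mul_I_im] at h
    exact h.neg
  -- |γ₁(v)| ≤ K|v|
  have hγ₁b : ∀ v : ℝ, |v| ≤ |a| → |γ₁ v| ≤ K * |v| := by
    intro v hv
    have hseg : ∀ u ∈ Set.Icc (-|v|) |v|, HasDerivWithinAt γ₁ (-(f'' (φ + (u : ℂ) * I)).re) (Set.Icc (-|v|) |v|) u :=
      fun u hu => (hγ₁d u (le_trans (abs_le.2 hu) hv)).hasDerivWithinAt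
    have hbound : ∀ u ∈ Set.Icc (-|v|) |v|, ‖-(f'' (φ + (u : ℂ) * I)).re‖ ≤ K := fun u hu => by
      rw [norm_neg, Real.norm_eq_abs]
      exact le_trans (Complex.abs_re_le_norm _) (hK u (le_trans (abs_le.2 hu) hv))
    have h := Convex.norm_image_sub_le_of_norm_hasDerivWithin_le hseg hbound (convex_Icc _ _)
      (show (0 : ℝ) ∈ Set.Icc (-|v|) |v| by constructor <;> linarith [abs_nonneg v])
      (show v ∈ Set.Icc (-|v|) |v| from ⟨neg_abs_le v, le_abs_self v⟩)
    have h0 : γ₁ 0 = 0 := by simp [hγ₁, him]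
    rw [h0, sub_zero, Real.norm_eq_abs, sub_zero, Real.norm_eq_abs] at h
    exact h
  have h := abs_sub_le_of_abs_deriv_le_mul hγd hγ₁b
  simp only [hγ, Complex.ofReal_zero, zero_mul, add_zero] at h
  exact h

/-- The complex derivative at a real point of a function that is real on the real axis is real.
[folklore] -/
theorem im_eq_zero_of_hasDerivAt_of_real {e : ℂ → ℂ} {e' : ℂ} {φ : ℝ} (h : HasDerivAt e e' φ)
    (hreal : ∀ y : ℝ, (e y).im = 0) : e'.im = 0 := by
  have h1 : HasDerivAt (fun y : ℝ => (e y).im) e'.im φ := by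
    have h1 := Complex.imCLM.hasFDerivAt.comp_hasDerivAt φ h.comp_ofReal
    simp only [Complex.imCLM_apply, Function.comp_def] at h1
    exact h1
  have h2 : HasDerivAt (fun y : ℝ => (e y).im) 0 φ := by
    have : (fun y : ℝ => (e y).im) = fun _ => 0 := funext hreal
    rw [this]; exact hasDerivAt_const φ 0
  exact h1.unique h2

/-! ### Cauchy estimates for the derivatives of `log E_x` -/

/-- `deriv (log E_x)` is entire. [folklore] -/
theorem differentiable_deriv_debyeLogEC {x : ℝ} (hx : 0 < x) : Differentiable ℂ (deriv (debyeLogEC x)) := by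
  have h := (Complex.analyticOnNhd_univ_iff_differentiable.2 (differentiable_debyeLogEC hx)).deriv
  exact Complex.analyticOnNhd_univ_iff_differentiable.1 h

/-- `deriv (deriv (log E_x))` is entire. [folklore] -/
theorem differentiable_deriv_deriv_debyeLogEC {x : ℝ} (hx : 0 < x) :
    Differentiable ℂ (deriv (deriv (debyeLogEC x))) := by
  have h := (Complex.analyticOnNhd_univ_iff_differentiable.2 (differentiable_deriv_debyeLogEC hx)).deriv
  exact Complex.analyticOnNhd_univ_iff_differentiable.1 h

/-- Points of the unit circle around `z` have imaginary part at most `|Im z| + 1`. [folklore] -/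
theorem abs_im_le_of_mem_sphere {z w : ℂ} {r : ℝ} (hw : w ∈ Metric.sphere z r) : |w.im| ≤ |z.im| + r := by
  rw [Metric.mem_sphere, Complex.dist_eq] at hw
  have h1 : |w.im - z.im| ≤ ‖w - z‖ := by
    have := Complex.abs_im_le_norm (w - z); simpa using this
  have h2 : |w.im| ≤ |z.im| + |w.im - z.im| := by
    have := abs_add_le z.im (w.im - z.im); simp at this; linarith
  linarith

/-- **Cauchy estimate, first derivative**: `‖(log E_x)'(z)‖ ≤ (1800/x) e^{2π(|Im z| + 1)}` (`x ≥ 100`).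
[folklore] -/
theorem norm_deriv_debyeLogEC_le {x : ℝ} (hx : 100 ≤ x) (z : ℂ) :
    ‖deriv (debyeLogEC x) z‖ ≤ 1800 / x * Real.exp (2 * π * (|z.im| + 1)) := by
  have hx0 : 0 < x := by linarith
  have h := Complex.norm_deriv_le_of_forall_mem_sphere_norm_le (f := debyeLogEC x) (c := z)
    (R := 1) (C := 1800 / x * Real.exp (2 * π * (|z.im| + 1))) one_pos
    ((differentiable_debyeLogEC hx0).diffContOnCl) (fun w hw => by
      calc ‖debyeLogEC x w‖ ≤ 1800 / x * Real.exp (2 * π * |w.im|) := norm_debyeLogEC_le hx w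
        _ ≤ 1800 / x * Real.exp (2 * π * (|z.im| + 1)) := by
            gcongr
            exact abs_im_le_of_mem_sphere hw)
  rwa [div_one] at h

/-- **Cauchy estimate, second derivative**: `‖(log E_x)''(z)‖ ≤ (1800/x) e^{2π(|Im z| + 2)}`
(`x ≥ 100`). [folklore] -/
theorem norm_deriv_deriv_debyeLogEC_le {x : ℝ} (hx : 100 ≤ x) (z : ℂ) :
    ‖deriv (deriv (debyeLogEC x)) z‖ ≤ 1800 / x * Real.exp (2 * π * (|z.im| + 2)) := by
  have hx0 : 0 < x := by linarith
  have h := Complex.norm_deriv_le_of_forall_mem_sphere_norm_le (f := deriv (debyeLogEC x)) (c := z)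
    (R := 1) (C := 1800 / x * Real.exp (2 * π * (|z.im| + 2))) one_pos
    ((differentiable_deriv_debyeLogEC hx0).diffContOnCl) (fun w hw => by
      calc ‖deriv (debyeLogEC x) w‖ ≤ 1800 / x * Real.exp (2 * π * (|w.im| + 1)) :=
            norm_deriv_debyeLogEC_le hx w
        _ ≤ 1800 / x * Real.exp (2 * π * (|z.im| + 2)) := by
            gcongr 1800 / x * Real.exp (2 * π * ?_)
            linarith [abs_im_le_of_mem_sphere hw])
  rwa [div_one] at h

/-! ### Fröhlich–Spencer's interpolation on the strip and properties (a), (c), (d) -/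

/-- `log I_x(z) = G_x(z) + log E_x(z)`. [cite: FrohlichSpencerKT1981, Appendix B, (B.14), p. 599] -/
def debyeLogI (x : ℝ) (z : ℂ) : ℂ := debyeG x z + debyeLogEC x z

/-- **Fröhlich–Spencer's analytic interpolation** `I_x(z) = L_x(z) E_x(z) = exp(G_x(z) + log E_x(z))`
of `n ↦ I_n(x)`, on the strip `|Im z| < x` (so in particular on `|Im z| ≤ x/2`).
[cite: FrohlichSpencerKT1981, Sect. 6, p. 576; Appendix B, (B.14), p. 599] -/
def besselIInterpC (x : ℝ) (z : ℂ) : ℂ := Complex.exp (debyeLogI x z)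

/-- `I_x` is zero-free. [cite: FrohlichSpencerKT1981, Sect. 6, p. 576] -/
theorem besselIInterpC_ne_zero (x : ℝ) (z : ℂ) : besselIInterpC x z ≠ 0 := Complex.exp_ne_zero _

/-- `log I_x` is complex differentiable on the strip `|Im z| < x`, with derivative
`G_x' + (log E_x)'`. [folklore] -/
theorem hasDerivAt_debyeLogI {x : ℝ} (hx : 0 < x) {z : ℂ} (hz : |z.im| < x) :
    HasDerivAt (debyeLogI x) (debyeG' x z + deriv (debyeLogEC x) z) z :=
  (hasDerivAt_debyeG hx hz).add (differentiable_debyeLogEC hx z).hasDerivAt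

/-- ... and the derivative is again differentiable, with derivative `G_x'' + (log E_x)''`. [folklore] -/
theorem hasDerivAt_debyeLogI' {x : ℝ} (hx : 0 < x) {z : ℂ} (hz : |z.im| < x) :
    HasDerivAt (fun z => debyeG' x z + deriv (debyeLogEC x) z)
      (debyeG'' x z + deriv (deriv (debyeLogEC x)) z) z :=
  (hasDerivAt_debyeG' hx hz).add (differentiable_deriv_debyeLogEC hx z).hasDerivAt

/-- **Analyticity**: `I_x` is complex differentiable on the open strip `|Im z| < x`.
[cite: FrohlichSpencerKT1981, Sect. 6, p. 576] -/
theorem differentiableOn_besselIInterpC {x : ℝ} (hx : 0 < x) :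
    DifferentiableOn ℂ (besselIInterpC x) {z : ℂ | |z.im| < x} := fun _ hz =>
  ((hasDerivAt_debyeLogI hx hz).cexp).differentiableAt.differentiableWithinAt

/-- On the real axis `log I_x` is real: `log I_x(φ) = log L_x(φ) + log E_x(φ)`. [folklore] -/
theorem debyeLogI_ofReal {x : ℝ} (hx : 0 < x) (φ : ℝ) :
    debyeLogI x φ = ((Real.log (debyeL x φ) + debyeLogE x φ : ℝ) : ℂ) := by
  unfold debyeLogI
  rw [debyeG_ofReal hx, debyeLogEC_ofReal]
  push_cast
  ring

/-- **(b) on the axis**: the complex interpolation restricts to the real one, `I_x(φ) = L_x(φ)E_x(φ)`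
(even, positive, continuous, integrable by `BesselIDebyeInterpolation`).
[cite: FrohlichSpencerKT1981, Sect. 6 (b), p. 576] -/
theorem besselIInterpC_ofReal {x : ℝ} (hx : 0 < x) (φ : ℝ) : besselIInterpC x φ = (besselIInterp x φ : ℝ) := by
  unfold besselIInterpC besselIInterp
  rw [debyeLogI_ofReal hx, ← Complex.ofReal_exp, Real.exp_add, Real.exp_log (debyeL_pos hx φ)]

/-- **(a)**: `I_x(m) = I_m(x)` for `m ∈ ℤ`. [cite: FrohlichSpencerKT1981, Sect. 6 (a), p. 576] -/
theorem besselIInterpC_intCast {x : ℝ} (hx : 0 < x) (m : ℤ) : besselIInterpC x m = (besselI m x : ℝ) := by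
  rw [show ((m : ℂ)) = ((m : ℝ) : ℂ) by norm_cast, besselIInterpC_ofReal hx, besselIInterp_intCast hx]

/-- The norm of `I_x` is `exp(Re log I_x)`; on the axis `I_x(φ) = exp(Re log I_x(φ))`. [folklore] -/
theorem norm_besselIInterpC (x : ℝ) (z : ℂ) : ‖besselIInterpC x z‖ = Real.exp (debyeLogI x z).re := by
  rw [besselIInterpC, Complex.norm_exp]

/-- On the axis `I_x(φ) = exp(Re log I_x(φ))`. [folklore] -/
theorem besselIInterp_eq_exp_re {x : ℝ} (hx : 0 < x) (φ : ℝ) :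
    besselIInterp x φ = Real.exp (debyeLogI x φ).re := by
  have h := norm_besselIInterpC x φ
  rw [besselIInterpC_ofReal hx, Complex.norm_real, Real.norm_eq_abs,
    abs_of_pos (besselIInterp_pos hx φ)] at h
  exact h

/-! #### (c): the ratio `|I_x(φ + ia)/I_x(φ)|` -/

/-- The `G`-part of (c) (this is (B.13)): `|Re G_x(φ + ia) - G_x(φ)| ≤ a²/x` for `|a| ≤ x/2`,
`x ≥ 100`. [cite: FrohlichSpencerKT1981, Appendix B, (B.13), p. 599] -/
theorem abs_re_debyeG_sub_le {x : ℝ} (hx : 100 ≤ x) (φ : ℝ) {a : ℝ} (ha : |a| ≤ x / 2) :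
    |(debyeG x (φ + (a : ℂ) * I)).re - (debyeG x φ).re| ≤ a ^ 2 / x := by
  have hx0 : 0 < x := by linarith
  have him : ∀ v : ℝ, |v| ≤ |a| → |((φ : ℂ) + (v : ℂ) * I).im| < x := fun v hv => by
    simp; linarith
  have him' : ∀ v : ℝ, |v| ≤ |a| → |((φ : ℂ) + (v : ℂ) * I).im| ≤ 3 / 4 * x := fun v hv => by
    simp; linarith
  have h := abs_re_sub_re_le_of_vertical (f := debyeG x) (f' := debyeG' x) (f'' := debyeG'' x)
    (φ := φ) (a := a) (K := 2 / x)
    (fun v hv => hasDerivAt_debyeG hx0 (him v hv)) (fun v hv => hasDerivAt_debyeG' hx0 (him v hv))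
    (debyeG'_ofReal_im x φ) (fun v hv => norm_debyeG''_le hx (him' v hv))
  calc _ ≤ 2 / x * a ^ 2 / 2 := h
    _ = a ^ 2 / x := by ring

/-- The `E`-part of (c), crude form: `|Re log E_x(φ+ia) - log E_x(φ)| ≤ (3600/x) e^{2π|a|}`. [folklore] -/
theorem abs_re_debyeLogEC_sub_le {x : ℝ} (hx : 100 ≤ x) (φ : ℝ) (a : ℝ) :
    |(debyeLogEC x (φ + (a : ℂ) * I)).re - (debyeLogEC x φ).re| ≤ 3600 / x * Real.exp (2 * π * |a|) := by
  have h1 := norm_debyeLogEC_le hx (φ + (a : ℂ) * I)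
  have h2 := norm_debyeLogEC_le hx φ
  simp only [Complex.add_im, Complex.ofReal_im, Complex.mul_im, Complex.ofReal_re, Complex.I_im,
    Complex.I_re, mul_one, mul_zero, zero_add, add_zero] at h1 h2
  rw [abs_zero, mul_zero, Real.exp_zero, mul_one] at h2
  have h3 : |(debyeLogEC x (φ + (a : ℂ) * I)).re| ≤ 1800 / x * Real.exp (2 * π * |a|) :=
    le_trans (Complex.abs_re_le_norm _) h1
  have h4 : |(debyeLogEC x φ).re| ≤ 1800 / x := le_trans (Complex.abs_re_le_norm _) h2
  have h5 : 1800 / x ≤ 1800 / x * Real.exp (2 * π * |a|) :=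
    le_mul_of_one_le_right (by positivity) (Real.one_le_exp (by positivity))
  calc _ ≤ |(debyeLogEC x (φ + (a : ℂ) * I)).re| + |(debyeLogEC x φ).re| := abs_sub _ _
    _ ≤ 1800 / x * Real.exp (2 * π * |a|) + 1800 / x * Real.exp (2 * π * |a|) := by linarith
    _ = 3600 / x * Real.exp (2 * π * |a|) := by ring

/-- The `E`-part of (c) for small `a`: `|Re log E_x(φ+ia) - log E_x(φ)| ≤ (900 e^{6π}/x) a²` for
`|a| ≤ 1` (second-order bound with the Cauchy estimate `‖(log E_x)''‖ ≤ (1800/x)e^{6π}` on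
`|Im z| ≤ 1`). [folklore] -/
theorem abs_re_debyeLogEC_sub_le_sq {x : ℝ} (hx : 100 ≤ x) (φ : ℝ) {a : ℝ} (ha : |a| ≤ 1) :
    |(debyeLogEC x (φ + (a : ℂ) * I)).re - (debyeLogEC x φ).re| ≤
      900 * Real.exp (6 * π) / x * a ^ 2 := by
  have hx0 : 0 < x := by linarith
  have hd := differentiable_debyeLogEC hx0
  have hd' := differentiable_deriv_debyeLogEC hx0
  have hreal : ∀ y : ℝ, (debyeLogEC x y).im = 0 := fun y => by
    rw [debyeLogEC_ofReal, Complex.ofReal_im]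
  have him0 : (deriv (debyeLogEC x) φ).im = 0 := im_eq_zero_of_hasDerivAt_of_real (hd φ).hasDerivAt hreal
  have h := abs_re_sub_re_le_of_vertical (f := debyeLogEC x) (f' := deriv (debyeLogEC x))
    (f'' := deriv (deriv (debyeLogEC x))) (φ := φ) (a := a) (K := 1800 / x * Real.exp (6 * π))
    (fun v _ => (hd _).hasDerivAt) (fun v _ => (hd' _).hasDerivAt) him0 (fun v hv => by
      have hv' : |((φ : ℂ) + (v : ℂ) * I).im| ≤ 1 := by simp; exact le_trans hv ha
      calc _ ≤ 1800 / x * Real.exp (2 * π * (|((φ : ℂ) + (v : ℂ) * I).im| + 2)) :=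
            norm_deriv_deriv_debyeLogEC_le hx _
        _ ≤ 1800 / x * Real.exp (6 * π) := by
            apply mul_le_mul_of_nonneg_left _ (by positivity)
            apply Real.exp_le_exp.2
            nlinarith [Real.pi_pos])
  calc _ ≤ 1800 / x * Real.exp (6 * π) * a ^ 2 / 2 := h
    _ = 900 * Real.exp (6 * π) / x * a ^ 2 := by ring

/-- **(c)**: for `x ≥ 100`, real `φ` and `|a| ≤ x/2`,
`|Re log I_x(φ + ia) - log I_x(φ)| ≤ (a² + 3600 e^{2π|a|})/x`; hence
`|I_x(φ + ia)/I_x(φ)| ≤ e^{g(a)/x}` with `g(a) = a² + 3600 e^{2π|a|} ≤ 3601 e^{2π|a|}`.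
[cite: FrohlichSpencerKT1981, Sect. 6 (c), p. 576] -/
theorem abs_re_debyeLogI_sub_le {x : ℝ} (hx : 100 ≤ x) (φ : ℝ) {a : ℝ} (ha : |a| ≤ x / 2) :
    |(debyeLogI x (φ + (a : ℂ) * I)).re - (debyeLogI x φ).re| ≤
      (a ^ 2 + 3600 * Real.exp (2 * π * |a|)) / x := by
  have h1 := abs_re_debyeG_sub_le hx φ ha
  have h2 := abs_re_debyeLogEC_sub_le hx φ a
  unfold debyeLogI
  simp only [Complex.add_re]
  calc _ = |((debyeG x (φ + (a : ℂ) * I)).re - (debyeG x φ).re) +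
        ((debyeLogEC x (φ + (a : ℂ) * I)).re - (debyeLogEC x φ).re)| := by ring_nf
    _ ≤ |(debyeG x (φ + (a : ℂ) * I)).re - (debyeG x φ).re| +
        |(debyeLogEC x (φ + (a : ℂ) * I)).re - (debyeLogEC x φ).re| := abs_add_le _ _
    _ ≤ a ^ 2 / x + 3600 / x * Real.exp (2 * π * |a|) := add_le_add h1 h2
    _ = (a ^ 2 + 3600 * Real.exp (2 * π * |a|)) / x := by ring

/-- **(c), small `a`**: for `|a| ≤ 1`, `|Re log I_x(φ + ia) - log I_x(φ)| ≤ (1 + 900 e^{6π}) a²/x`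
(`g(a) ≤ const · a²`). [cite: FrohlichSpencerKT1981, Sect. 6 (c), p. 576] -/
theorem abs_re_debyeLogI_sub_le_sq {x : ℝ} (hx : 100 ≤ x) (φ : ℝ) {a : ℝ} (ha : |a| ≤ 1) :
    |(debyeLogI x (φ + (a : ℂ) * I)).re - (debyeLogI x φ).re| ≤
      (1 + 900 * Real.exp (6 * π)) * a ^ 2 / x := by
  have ha' : |a| ≤ x / 2 := by linarith
  have h1 := abs_re_debyeG_sub_le hx φ ha'
  have h2 := abs_re_debyeLogEC_sub_le_sq hx φ ha
  unfold debyeLogI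
  simp only [Complex.add_re]
  calc _ = |((debyeG x (φ + (a : ℂ) * I)).re - (debyeG x φ).re) +
        ((debyeLogEC x (φ + (a : ℂ) * I)).re - (debyeLogEC x φ).re)| := by ring_nf
    _ ≤ |(debyeG x (φ + (a : ℂ) * I)).re - (debyeG x φ).re| +
        |(debyeLogEC x (φ + (a : ℂ) * I)).re - (debyeLogEC x φ).re| := abs_add_le _ _
    _ ≤ a ^ 2 / x + 900 * Real.exp (6 * π) / x * a ^ 2 := add_le_add h1 h2
    _ = (1 + 900 * Real.exp (6 * π)) * a ^ 2 / x := by ring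

/-- **(c), ratio form**: `‖I_x(φ + ia)‖ ≤ exp((a² + 3600 e^{2π|a|})/x) · I_x(φ)` and
`I_x(φ) ≤ exp((a² + 3600 e^{2π|a|})/x) · ‖I_x(φ + ia)‖` (`x ≥ 100`, `|a| ≤ x/2`).
[cite: FrohlichSpencerKT1981, Sect. 6 (c), p. 576] -/
theorem norm_besselIInterpC_le {x : ℝ} (hx : 100 ≤ x) (φ : ℝ) {a : ℝ} (ha : |a| ≤ x / 2) :
    ‖besselIInterpC x (φ + (a : ℂ) * I)‖ ≤
      Real.exp ((a ^ 2 + 3600 * Real.exp (2 * π * |a|)) / x) * besselIInterp x φ ∧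
    besselIInterp x φ ≤
      Real.exp ((a ^ 2 + 3600 * Real.exp (2 * π * |a|)) / x) * ‖besselIInterpC x (φ + (a : ℂ) * I)‖ := by
  have hx0 : 0 < x := by linarith
  have h := abs_re_debyeLogI_sub_le hx φ ha
  rw [abs_le] at h
  rw [norm_besselIInterpC, besselIInterp_eq_exp_re hx0, ← Real.exp_add, ← Real.exp_add]
  constructor <;> (apply Real.exp_le_exp.2; linarith)

/-! #### (d): the `φ`-derivatives of `log(I_x(φ + ia)/I_x(φ))` -/

/-- Differentiating along the real direction: `φ ↦ log I_x(φ + ia) - log I_x(φ)` has derivative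
`F'(φ + ia) - F'(φ)`, `F' = G_x' + (log E_x)'` (`|a| < x`). [folklore] -/
theorem hasDerivAt_debyeLogI_shift {x : ℝ} (hx : 0 < x) {a : ℝ} (ha : |a| < x) (φ : ℝ) :
    HasDerivAt (fun φ : ℝ => debyeLogI x (φ + (a : ℂ) * I) - debyeLogI x φ)
      ((debyeG' x (φ + (a : ℂ) * I) + deriv (debyeLogEC x) (φ + (a : ℂ) * I)) -
        (debyeG' x φ + deriv (debyeLogEC x) φ)) φ := by
  have h1 : HasDerivAt (fun z : ℂ => debyeLogI x (z + (a : ℂ) * I))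
      (debyeG' x (φ + (a : ℂ) * I) + deriv (debyeLogEC x) (φ + (a : ℂ) * I)) (φ : ℂ) := by
    have hz : |(((φ : ℂ)) + (a : ℂ) * I).im| < x := by simp; exact ha
    have := HasDerivAt.comp (φ : ℂ) (hasDerivAt_debyeLogI hx hz) ((hasDerivAt_id (φ : ℂ)).add_const ((a : ℂ) * I))
    simp only [mul_one, Function.comp_def, id] at this
    exact this
  have h2 : HasDerivAt (debyeLogI x) (debyeG' x φ + deriv (debyeLogEC x) φ) (φ : ℂ) :=
    hasDerivAt_debyeLogI hx (by simp; exact hx)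
  exact (h1.sub h2).comp_ofReal

/-- Same for the derivative: `φ ↦ F'(φ + ia) - F'(φ)` has derivative `F''(φ + ia) - F''(φ)`.
[folklore] -/
theorem hasDerivAt_debyeLogI'_shift {x : ℝ} (hx : 0 < x) {a : ℝ} (ha : |a| < x) (φ : ℝ) :
    HasDerivAt (fun φ : ℝ => (debyeG' x (φ + (a : ℂ) * I) + deriv (debyeLogEC x) (φ + (a : ℂ) * I)) -
        (debyeG' x φ + deriv (debyeLogEC x) φ))
      ((debyeG'' x (φ + (a : ℂ) * I) + deriv (deriv (debyeLogEC x)) (φ + (a : ℂ) * I)) -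
        (debyeG'' x φ + deriv (deriv (debyeLogEC x)) φ)) φ := by
  have h1 : HasDerivAt (fun z : ℂ => debyeG' x (z + (a : ℂ) * I) + deriv (debyeLogEC x) (z + (a : ℂ) * I))
      (debyeG'' x (φ + (a : ℂ) * I) + deriv (deriv (debyeLogEC x)) (φ + (a : ℂ) * I)) (φ : ℂ) := by
    have hz : |(((φ : ℂ)) + (a : ℂ) * I).im| < x := by simp; exact ha
    have := HasDerivAt.comp (φ : ℂ) (hasDerivAt_debyeLogI' hx hz) ((hasDerivAt_id (φ : ℂ)).add_const ((a : ℂ) * I))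
    simp only [mul_one, Function.comp_def, id] at this
    exact this
  have h2 : HasDerivAt (fun z => debyeG' x z + deriv (debyeLogEC x) z)
      (debyeG'' x φ + deriv (deriv (debyeLogEC x)) φ) (φ : ℂ) :=
    hasDerivAt_debyeLogI' hx (by simp; exact hx)
  exact (h1.sub h2).comp_ofReal

/-- **(d), m = 1**: `‖F'(φ + ia) - F'(φ)‖ ≤ (2|a| + 3600 e^{2π} e^{2π|a|})/x` for `|a| ≤ x/2`,
`x ≥ 100` (`≤ C x⁻¹ e^{2π|a|}`). [cite: FrohlichSpencerKT1981, Sect. 6 (d), p. 576] -/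
theorem norm_debyeLogI'_sub_le {x : ℝ} (hx : 100 ≤ x) (φ : ℝ) {a : ℝ} (ha : |a| ≤ x / 2) :
    ‖(debyeG' x (φ + (a : ℂ) * I) + deriv (debyeLogEC x) (φ + (a : ℂ) * I)) -
        (debyeG' x φ + deriv (debyeLogEC x) φ)‖ ≤
      (2 * |a| + 3600 * Real.exp (2 * π) * Real.exp (2 * π * |a|)) / x := by
  have hx0 : 0 < x := by linarith
  have him : ∀ v : ℝ, |v| ≤ |a| → |((φ : ℂ) + (v : ℂ) * I).im| < x := fun v hv => by
    simp; linarith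
  have him' : ∀ v : ℝ, |v| ≤ |a| → |((φ : ℂ) + (v : ℂ) * I).im| ≤ 3 / 4 * x := fun v hv => by
    simp; linarith
  -- G-part: first order along the vertical segment
  have hG := norm_sub_le_of_vertical (f := debyeG' x) (f' := debyeG'' x) (φ := φ) (a := a) (K := 2 / x)
    (fun v hv => hasDerivAt_debyeG' hx0 (him v hv)) (fun v hv => norm_debyeG''_le hx (him' v hv))
  -- E-part: two Cauchy estimates
  have hE1 := norm_deriv_debyeLogEC_le hx (φ + (a : ℂ) * I)
  have hE2 := norm_deriv_debyeLogEC_le hx φ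
  simp only [Complex.add_im, Complex.ofReal_im, Complex.mul_im, Complex.ofReal_re, Complex.I_im,
    Complex.I_re, mul_one, mul_zero, zero_add, add_zero] at hE1 hE2
  rw [abs_zero, zero_add] at hE2
  have hexp : Real.exp (2 * π * (|a| + 1)) = Real.exp (2 * π) * Real.exp (2 * π * |a|) := by
    rw [← Real.exp_add]; ring_nf
  have hE2' : ‖deriv (debyeLogEC x) φ‖ ≤ 1800 / x * (Real.exp (2 * π) * Real.exp (2 * π * |a|)) := by
    calc _ ≤ 1800 / x * Real.exp (2 * π * 1) := hE2
      _ ≤ 1800 / x * (Real.exp (2 * π) * Real.exp (2 * π * |a|)) := by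
          rw [mul_one]
          gcongr
          exact le_mul_of_one_le_right (Real.exp_pos _).le (Real.one_le_exp (by positivity))
  rw [hexp] at hE1
  calc _ = ‖(debyeG' x (φ + (a : ℂ) * I) - debyeG' x φ) +
        (deriv (debyeLogEC x) (φ + (a : ℂ) * I) - deriv (debyeLogEC x) φ)‖ := by ring_nf
    _ ≤ ‖debyeG' x (φ + (a : ℂ) * I) - debyeG' x φ‖ +
        ‖deriv (debyeLogEC x) (φ + (a : ℂ) * I) - deriv (debyeLogEC x) φ‖ := norm_add_le _ _
    _ ≤ 2 / x * |a| + (‖deriv (debyeLogEC x) (φ + (a : ℂ) * I)‖ + ‖deriv (debyeLogEC x) φ‖) :=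
        add_le_add hG (norm_sub_le _ _)
    _ ≤ 2 / x * |a| + (1800 / x * (Real.exp (2 * π) * Real.exp (2 * π * |a|)) +
        1800 / x * (Real.exp (2 * π) * Real.exp (2 * π * |a|))) := by gcongr
    _ = (2 * |a| + 3600 * Real.exp (2 * π) * Real.exp (2 * π * |a|)) / x := by ring

/-- **(d), m = 2**: `‖F''(φ + ia) - F''(φ)‖ ≤ (4 + 3600 e^{4π} e^{2π|a|})/x` for `|a| ≤ x/2`,
`x ≥ 100`. [cite: FrohlichSpencerKT1981, Sect. 6 (d), p. 576] -/
theorem norm_debyeLogI''_sub_le {x : ℝ} (hx : 100 ≤ x) (φ : ℝ) {a : ℝ} (ha : |a| ≤ x / 2) :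
    ‖(debyeG'' x (φ + (a : ℂ) * I) + deriv (deriv (debyeLogEC x)) (φ + (a : ℂ) * I)) -
        (debyeG'' x φ + deriv (deriv (debyeLogEC x)) φ)‖ ≤
      (4 + 3600 * Real.exp (4 * π) * Real.exp (2 * π * |a|)) / x := by
  have hx0 : 0 < x := by linarith
  have hG1 : ‖debyeG'' x (φ + (a : ℂ) * I)‖ ≤ 2 / x := norm_debyeG''_le hx (by simp; linarith)
  have hG2 : ‖debyeG'' x φ‖ ≤ 2 / x := norm_debyeG''_le hx (by simp; linarith)
  have hE1 := norm_deriv_deriv_debyeLogEC_le hx (φ + (a : ℂ) * I)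
  have hE2 := norm_deriv_deriv_debyeLogEC_le hx φ
  simp only [Complex.add_im, Complex.ofReal_im, Complex.mul_im, Complex.ofReal_re, Complex.I_im,
    Complex.I_re, mul_one, mul_zero, zero_add, add_zero] at hE1 hE2
  rw [abs_zero, zero_add] at hE2
  have hexp : Real.exp (2 * π * (|a| + 2)) = Real.exp (4 * π) * Real.exp (2 * π * |a|) := by
    rw [← Real.exp_add]; ring_nf
  have hE2' : ‖deriv (deriv (debyeLogEC x)) φ‖ ≤ 1800 / x * (Real.exp (4 * π) * Real.exp (2 * π * |a|)) := by
    calc _ ≤ 1800 / x * Real.exp (2 * π * 2) := hE2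
      _ ≤ 1800 / x * (Real.exp (4 * π) * Real.exp (2 * π * |a|)) := by
          rw [show 2 * π * 2 = 4 * π by ring]
          gcongr
          exact le_mul_of_one_le_right (Real.exp_pos _).le (Real.one_le_exp (by positivity))
  rw [hexp] at hE1
  calc _ = ‖(debyeG'' x (φ + (a : ℂ) * I) - debyeG'' x φ) +
        (deriv (deriv (debyeLogEC x)) (φ + (a : ℂ) * I) - deriv (deriv (debyeLogEC x)) φ)‖ := by ring_nf
    _ ≤ ‖debyeG'' x (φ + (a : ℂ) * I) - debyeG'' x φ‖ +
        ‖deriv (deriv (debyeLogEC x)) (φ + (a : ℂ) * I) - deriv (deriv (debyeLogEC x)) φ‖ :=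
        norm_add_le _ _
    _ ≤ (‖debyeG'' x (φ + (a : ℂ) * I)‖ + ‖debyeG'' x φ‖) +
        (‖deriv (deriv (debyeLogEC x)) (φ + (a : ℂ) * I)‖ + ‖deriv (deriv (debyeLogEC x)) φ‖) :=
        add_le_add (norm_sub_le _ _) (norm_sub_le _ _)
    _ ≤ (2 / x + 2 / x) + (1800 / x * (Real.exp (4 * π) * Real.exp (2 * π * |a|)) +
        1800 / x * (Real.exp (4 * π) * Real.exp (2 * π * |a|))) := by gcongr
    _ = (4 + 3600 * Real.exp (4 * π) * Real.exp (2 * π * |a|)) / x := by ring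

/-! ### Summary: the statement of [FS81, Sect. 6, p. 576 / Appendix B] -/

/-- `a² ≤ e^{2π|a|}` and `2|a| ≤ e^{2π|a|}`. [folklore] -/
theorem sq_le_exp_two_pi_abs (a : ℝ) : a ^ 2 ≤ Real.exp (2 * π * |a|) ∧ 2 * |a| ≤ Real.exp (2 * π * |a|) := by
  have hπ : 3 < π := Real.pi_gt_three
  have h1 : 1 + 2 * π * |a| ≤ Real.exp (2 * π * |a|) := by
    linarith [Real.add_one_le_exp (2 * π * |a|)]
  have h0 : 0 ≤ |a| := abs_nonneg a
  constructor
  · -- a² ≤ (2π|a|)²/2 + ... use e^y ≥ 1 + y + y²/2 via two steps of `add_one_le_exp`? simpler: e^y ≥ (1 + y/2)²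
    have h2 : (1 + π * |a|) ^ 2 ≤ Real.exp (2 * π * |a|) := by
      have h3 : 1 + π * |a| ≤ Real.exp (π * |a|) := by linarith [Real.add_one_le_exp (π * |a|)]
      have h4 : 0 ≤ 1 + π * |a| := by positivity
      calc (1 + π * |a|) ^ 2 ≤ Real.exp (π * |a|) ^ 2 := pow_le_pow_left₀ h4 h3 2
        _ = Real.exp (2 * π * |a|) := by rw [← Real.exp_nat_mul]; ring_nf
    have h5 : a ^ 2 = |a| ^ 2 := (sq_abs a).symm
    have h6 : |a| ^ 2 ≤ (1 + π * |a|) ^ 2 := by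
      apply pow_le_pow_left₀ h0
      nlinarith
    rw [h5]
    exact h6.trans h2
  · nlinarith

/-- **Fröhlich–Spencer's interpolation theorem** ([FS81, Sect. 6, p. 576, "The existence of such a
function is proven in Appendix B"]), for the tree's `besselI` and `x = β ≥ 100`, with explicit
constants: there are `I = besselIInterpC x` and `F = debyeLogI x` with `I = exp ∘ F`, `I` complex
differentiable and zero-free on the strip `|Im z| < x`, such that
(a) `I(m) = I_m(x)` (`m ∈ ℤ`); (b) on `ℝ`, `I` is the real, even, positive, continuous, integrable
`besselIInterp x`; (c) `|Re F(φ+ia) - F(φ)| ≤ C e^{2π|a|}/x` for `|a| ≤ x/2` and `≤ C₂ a²/x` for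
`|a| ≤ 1` (so `|I(φ+ia)/I(φ)| ≤ e^{g(a)/x}`, `g(a) ≤ C₂a²`, `g(a) ≤ Ce^{2π|a|}`);
(d) the first two `φ`-derivatives of `F(φ+ia) - F(φ)` exist and are bounded by `C e^{2π|a|}/x`,
uniformly in `φ ∈ ℝ`, `|a| ≤ x/2`; here `C = 4 + 3600e^{4π}`, `C₂ = 1 + 900e^{6π}`.
[cite: FrohlichSpencerKT1981, Sect. 6 (a)–(d), p. 576; Appendix B, p. 599] -/
theorem frohlichSpencer_interpolation {x : ℝ} (hx : 100 ≤ x) :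
    (∀ z : ℂ, besselIInterpC x z = Complex.exp (debyeLogI x z)) ∧
    DifferentiableOn ℂ (besselIInterpC x) {z : ℂ | |z.im| < x} ∧
    (∀ z : ℂ, besselIInterpC x z ≠ 0) ∧
    (∀ m : ℤ, besselIInterpC x m = (besselI m x : ℝ)) ∧
    (∀ φ : ℝ, besselIInterpC x φ = (besselIInterp x φ : ℝ) ∧ besselIInterp x (-φ) = besselIInterp x φ ∧
      0 < besselIInterp x φ) ∧ Continuous (besselIInterp x) ∧ Integrable (besselIInterp x) ∧
    (∀ (φ a : ℝ), |a| ≤ x / 2 →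
      |(debyeLogI x (φ + (a : ℂ) * I)).re - (debyeLogI x φ).re| ≤
        (4 + 3600 * Real.exp (4 * π)) * Real.exp (2 * π * |a|) / x) ∧
    (∀ (φ a : ℝ), |a| ≤ 1 →
      |(debyeLogI x (φ + (a : ℂ) * I)).re - (debyeLogI x φ).re| ≤
        (1 + 900 * Real.exp (6 * π)) * a ^ 2 / x) ∧
    (∀ (φ a : ℝ), |a| ≤ x / 2 → ∃ D₁ D₂ : ℂ,
      HasDerivAt (fun φ : ℝ => debyeLogI x (φ + (a : ℂ) * I) - debyeLogI x φ) D₁ φ ∧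
      HasDerivAt (fun φ : ℝ => (debyeG' x (φ + (a : ℂ) * I) + deriv (debyeLogEC x) (φ + (a : ℂ) * I)) -
        (debyeG' x φ + deriv (debyeLogEC x) φ)) D₂ φ ∧
      D₁ = (debyeG' x (φ + (a : ℂ) * I) + deriv (debyeLogEC x) (φ + (a : ℂ) * I)) -
        (debyeG' x φ + deriv (debyeLogEC x) φ) ∧
      ‖D₁‖ ≤ (4 + 3600 * Real.exp (4 * π)) * Real.exp (2 * π * |a|) / x ∧
      ‖D₂‖ ≤ (4 + 3600 * Real.exp (4 * π)) * Real.exp (2 * π * |a|) / x) := by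
  have hx0 : 0 < x := by linarith
  have he2 : 1 ≤ Real.exp (2 * π) := Real.one_le_exp (by positivity)
  have he4 : Real.exp (2 * π) ≤ Real.exp (4 * π) := Real.exp_le_exp.2 (by nlinarith [Real.pi_pos])
  refine ⟨fun z => rfl, differentiableOn_besselIInterpC hx0, besselIInterpC_ne_zero x,
    besselIInterpC_intCast hx0, fun φ => ⟨besselIInterpC_ofReal hx0 φ, besselIInterp_neg x φ,
    besselIInterp_pos hx0 φ⟩, continuous_besselIInterp hx0, integrable_besselIInterp hx, ?_,
    fun φ a ha => abs_re_debyeLogI_sub_le_sq hx φ ha, ?_⟩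
  · intro φ a ha
    obtain ⟨h1, _⟩ := sq_le_exp_two_pi_abs a
    have hE : 0 ≤ Real.exp (2 * π * |a|) := (Real.exp_pos _).le
    calc _ ≤ (a ^ 2 + 3600 * Real.exp (2 * π * |a|)) / x := abs_re_debyeLogI_sub_le hx φ ha
      _ ≤ (4 + 3600 * Real.exp (4 * π)) * Real.exp (2 * π * |a|) / x := by
          gcongr
          nlinarith
  · intro φ a ha
    have ha' : |a| < x := by linarith
    refine ⟨_, _, hasDerivAt_debyeLogI_shift hx0 ha' φ, hasDerivAt_debyeLogI'_shift hx0 ha' φ, rfl, ?_, ?_⟩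
    · obtain ⟨_, h2⟩ := sq_le_exp_two_pi_abs a
      have hE : 0 ≤ Real.exp (2 * π * |a|) := (Real.exp_pos _).le
      calc _ ≤ (2 * |a| + 3600 * Real.exp (2 * π) * Real.exp (2 * π * |a|)) / x :=
            norm_debyeLogI'_sub_le hx φ ha
        _ ≤ (4 + 3600 * Real.exp (4 * π)) * Real.exp (2 * π * |a|) / x := by
            gcongr
            nlinarith
    · have hE : 0 ≤ Real.exp (2 * π * |a|) := (Real.exp_pos _).le
      calc _ ≤ (4 + 3600 * Real.exp (4 * π) * Real.exp (2 * π * |a|)) / x :=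
            norm_debyeLogI''_sub_le hx φ ha
        _ ≤ (4 + 3600 * Real.exp (4 * π)) * Real.exp (2 * π * |a|) / x := by
            gcongr
            have h1 : 1 ≤ Real.exp (2 * π * |a|) := Real.one_le_exp (by positivity)
            nlinarith

end Literature.Probability.LatticeModels
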